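import Literature.NumberTheory.Sieve.IwaniecAlmostPrimesProp2Prep
import Literature.NumberTheory.Sieve.IwaniecAlmostPrimesQuadraticMertens
import Literature.NumberTheory.Sieve.IwaniecAlmostPrimesQuadraticSection6
import Literature.NumberTheory.Sieve.PolynomialCongruencesLemmas
import Literature.NumberTheory.Sieve.PolynomialCongruencesRootCount
import HarnessLib

/-!
# Iwaniec (1978) for a general quadratic, §5: the proof of Proposition 2 for `𝒜_G` — interface of Lemma 2, classes, main terms

Sequel to `IwaniecAlmostPrimesQuadraticMertens.lean` and the general-`G` counterpart of
`IwaniecAlmostPrimesProp2Prep.lean` (H. Iwaniec, *Almost-primes represented by quadratic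
polynomials*, Invent. Math. **47** (1978) 171–188 [cite: IwaniecInventiones1978, §5 pp. 185–186];
R. J. Lemke Oliver, Acta Arith. **151** (2012) 241–261 [cite: LemkeOliverActaArith2012, Lemma 5]:
"This is essentially the same as Proposition 2 in [8], so we present it without proof").
Proposition 2 for `𝒜_G = {G(n) : n ≤ x}` (the predicates `proposition2G_upper`,
`proposition2G_lower_const` of `IwaniecAlmostPrimesQuadraticSection6.lean`) is derived in the
sequels from Iwaniec's bilinear linear sieve (`lemma2_bilinearSieve`) and the level of
distribution of `𝒜_G` in bilinear form; this file supplies, fully PROVED, the `G`-dependent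
infrastructure, mirroring the `n² + 1` file item by item:

* `congrCountG`, `remG`, `bilinearBG` — `|𝒜_d|`, `r(𝒜; d) = |𝒜_d| − ρ_G(d) x/d`,
  `B(x; m, N) = ∑_{n<N, (n,m)=1} b_n r(𝒜; mn)` for `𝒜 = 𝒜_G` (members read through `|G(n)|`);
* **`ℬ = 𝒜_q`**: `multisetAqG`, `msifted_multisetAqG`, `mcount_multisetAqG_of_coprime`,
  `rhoG_mul_of_coprime` (CRT, the tree's `polyRootCountMod_mul_of_coprime`), `remG_mul_eq_of_coprime`,
  `rhoGArith` (multiplicative, `0 ≤ ρ_G(p) < p`), `exists_rhoG_primePow_le` (`ρ_G(p^a) ≤ B_G`,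
  the tree's Nagell-type `exists_polyRootCountMod_prime_pow_le`), `rhoG_condition_two`
  (condition (2) of Lemma 2 for `ω = ρ_G`), and the packaged application **`lemma2_multisetAqG`**
  of `lemma2_bilinearSieve` to `𝒜_q` with `X = ρ_G(q) x/q`, `ω = ρ_G` (conditions (1), (2)
  discharged by `rhoG_sieveConditionOne`, `rhoG_condition_two`);
* **classes**: `remainder_eq_sum_bilinearBG`, **`abs_remainder_class_leG`**;
* **densities**: `lambda0G = 2Γ_G e^{−γ}`, `eventually_forall_abs_densityProdG_mul_log_sub_le`
  (uniform form of `V_G(t) log t → Λ₀`), `rhoGDivArith`, **`eventually_sum_rough_rhoG_div_le`**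
  (`∑_{q<x, (q,P(x^γ))=1} ρ_G(q)/q ≤ B_γ`), `siftedCountG_eq_zero_of_rhoG_eq_zero`;
* **main terms of a single `q`**, generic in the density `V > 0` and its limit `Λ₀ > 0`:
  `main_term_upper_gen`, `densityProd_level_le_gen`, `main_term_lower_gen`,
  `main_term_lower_trivial_gen` (the `n² + 1` statements of `IwaniecAlmostPrimesProp2Prep.lean`
  with `densityProd`, `lambda0` abstracted; same proofs).

No named fact is introduced.

## References

* H. Iwaniec, Invent. Math. 47 (1978) 171–188, §5 (`IwaniecInventiones1978`).
* H. Iwaniec, Acta Arith. 37 (1980) 307–320, Theorem 1 and conditions (1), (2)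
  (`IwaniecActaArith1980b`).
* R. J. Lemke Oliver, Acta Arith. 151 (2012) 241–261, Lemma 5 (`LemkeOliverActaArith2012`).
-/

open Finset Real Polynomial Filter
open scoped Topology

noncomputable section

namespace Literature.NumberTheory.Sieve.Iwaniec1978

variable {a b c : ℤ}

/-! ### The sieve data of `𝒜_G`: `|𝒜_d|`, `r(𝒜; d)`, `B(x; m, N)` -/

open scoped Classical in
/-- `|𝒜_d| = #{1 ≤ n ≤ x : d ∣ |G(n)|}` (Iwaniec p. 174 `𝒜_q`; Lemke Oliver (2.4)).
[cite: LemkeOliverActaArith2012, §2.1 (2.4)] -/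
def congrCountG (a b c : ℤ) (x : ℝ) (d : ℕ) : ℕ :=
  ((Finset.Icc 1 ⌊x⌋₊).filter fun n : ℕ => d ∣ gAbs a b c n).card

/-- `r(𝒜; d) = |𝒜_d| − ρ_G(d) x/d`, the remainder of the level-of-distribution approximation for
`𝒜 = 𝒜_G` with `X = x` (Iwaniec p. 175; Lemke Oliver (2.6)). [cite: LemkeOliverActaArith2012, §2.2 (2.6)] -/
def remG (a b c : ℤ) (x : ℝ) (d : ℕ) : ℝ :=
  (congrCountG a b c x d : ℝ) - (rhoG a b c d : ℝ) * x / d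

/-- `B(x; m, N) = ∑_{n < N, (n, m) = 1} b_n r(𝒜; mn)` for `𝒜 = 𝒜_G` (Iwaniec p. 175).
[cite: IwaniecInventiones1978, §4 p. 175] -/
def bilinearBG (a b c : ℤ) (x : ℝ) (bc : ℕ → ℝ) (m : ℕ) (N : ℝ) : ℝ :=
  ∑ n ∈ (Finset.Ico 1 ⌈N⌉₊).filter (fun n : ℕ => n.Coprime m), bc n * remG a b c x (m * n)

/-! ### `ℬ = 𝒜_q` as a multiset, and `r(ℬ, d) = r(𝒜; qd)` -/

open scoped Classical in
/-- `𝒜_q = {|G(n)| : 1 ≤ n ≤ x, q ∣ G(n)}` as a multiset of integers (the `ℬ` fed to Lemma 2,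
p. 185). [cite: IwaniecInventiones1978, §5 p. 185] -/
def multisetAqG (a b c : ℤ) (x : ℝ) (q : ℕ) : Multiset ℤ :=
  (((Finset.Icc 1 ⌊x⌋₊).filter fun n : ℕ => q ∣ gAbs a b c n).val.map
    fun n : ℕ => ((gAbs a b c n : ℕ) : ℤ))

open scoped Classical in
/-- `S(𝒜_q, u)` in the multiset interface equals `siftedCountG x q u`. [folklore] -/
theorem msifted_multisetAqG (x : ℝ) (q : ℕ) (u : ℝ) :
    msifted (multisetAqG a b c x q) u = siftedCountG a b c x q u := by
  unfold msifted multisetAqG siftedCountG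
  rw [Multiset.filter_map, Multiset.card_map, ← Finset.filter_val, Finset.card_val,
    Finset.filter_filter]
  congr 1

open scoped Classical in
/-- `|(𝒜_q)_d| = #{1 ≤ n ≤ x : q ∣ |G(n)|, d ∣ |G(n)|}`. [folklore] -/
theorem mcount_multisetAqG (x : ℝ) (q d : ℕ) :
    mcount (multisetAqG a b c x q) d =
      ((Finset.Icc 1 ⌊x⌋₊).filter fun n : ℕ => q ∣ gAbs a b c n ∧ d ∣ gAbs a b c n).card := by
  unfold mcount multisetAqG
  rw [Multiset.filter_map, Multiset.card_map, ← Finset.filter_val, Finset.card_val,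
    Finset.filter_filter]
  congr 1
  refine Finset.filter_congr fun n _ => ?_
  simp only [Function.comp]
  exact and_congr_right fun _ => by exact_mod_cast Int.natCast_dvd_natCast

open scoped Classical in
/-- For `(q, d) = 1`: `|(𝒜_q)_d| = |𝒜_{qd}|`. [folklore] -/
theorem mcount_multisetAqG_of_coprime (x : ℝ) {q d : ℕ} (h : q.Coprime d) :
    mcount (multisetAqG a b c x q) d = congrCountG a b c x (q * d) := by
  rw [mcount_multisetAqG, congrCountG]
  congr 1
  refine Finset.filter_congr fun n _ => ?_
  constructor
  · rintro ⟨hq, hd⟩; exact h.mul_dvd_of_dvd_of_dvd hq hd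
  · intro hqd; exact ⟨dvd_trans (dvd_mul_right q d) hqd, dvd_trans (dvd_mul_left d q) hqd⟩

/-- **Multiplicativity of `ρ_G`** on coprime arguments (Chinese remainder theorem; the tree's
`polyRootCountMod_mul_of_coprime`). [cite: IwaniecInventiones1978, §4 p. 176] -/
theorem rhoG_mul_of_coprime {m n : ℕ} (h : m.Coprime n) :
    rhoG a b c (m * n) = rhoG a b c m * rhoG a b c n := by
  unfold rhoG
  exact Literature.NumberTheory.Sieve.polyRootCountMod_mul_of_coprime (quadPoly a b c) h

/-- `ρ_G(0) = 0`. [folklore] -/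
theorem rhoG_zero : rhoG a b c 0 = 0 := by
  simp [rhoG, polyRootCountMod]

/-- **The remainder of `ℬ = 𝒜_q` in Lemma 2's normalisation:** for `(q, d) = 1`, `q, d ≠ 0`,
`|ℬ_d| − (ρ_G(d)/d) X` with `X = ρ_G(q) x/q` equals `r(𝒜; qd)` (p. 185).
[cite: IwaniecInventiones1978, §5 p. 185] -/
theorem remG_mul_eq_of_coprime (x : ℝ) {q d : ℕ} (hq : q ≠ 0) (hd : d ≠ 0) (h : q.Coprime d) :
    remG a b c x (q * d) =
      (mcount (multisetAqG a b c x q) d : ℝ) -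
        (rhoG a b c d : ℝ) / d * ((rhoG a b c q : ℝ) * x / q) := by
  rw [remG, mcount_multisetAqG_of_coprime x h, rhoG_mul_of_coprime h]
  have hq' : (q : ℝ) ≠ 0 := by exact_mod_cast hq
  have hd' : (d : ℝ) ≠ 0 := by exact_mod_cast hd
  push_cast
  field_simp

/-! ### `ρ_G` as a multiplicative arithmetic function; prime powers; condition (2) of Lemma 2 -/

/-- `ρ_G` as a real arithmetic function (the `ω` of Lemma 2 for `ℬ = 𝒜_q`). [folklore] -/
def rhoGArith (a b c : ℤ) : ArithmeticFunction ℝ :=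
  ⟨fun n => (rhoG a b c n : ℝ), by simp [rhoG_zero]⟩

/-- `rhoGArith n = ρ_G(n)`. [folklore] -/
@[simp] theorem rhoGArith_apply (n : ℕ) : rhoGArith a b c n = (rhoG a b c n : ℝ) := rfl

/-- `ρ_G` is multiplicative. [cite: IwaniecInventiones1978, §4 p. 176] -/
theorem isMultiplicative_rhoGArith : ArithmeticFunction.IsMultiplicative (rhoGArith a b c) := by
  refine ⟨by simp [rhoGArith_apply, rhoG_one], fun {m n} h => ?_⟩
  simp only [rhoGArith_apply]
  exact_mod_cast rhoG_mul_of_coprime h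

/-- `0 ≤ ρ_G(n)`. [folklore] -/
theorem rhoGArith_nonneg (n : ℕ) : 0 ≤ rhoGArith a b c n := by simp

/-- `ρ_G(p) < p` for a prime `p` (no fixed prime divisor). [folklore] -/
theorem rhoGArith_lt_prime (ha : 0 < a) (hc : Odd c) (hirr : Irreducible (quadPoly a b c))
    {p : ℕ} (hp : p.Prime) : rhoGArith a b c p < p := by
  simp only [rhoGArith_apply]
  exact_mod_cast polyRootCountMod_quadPoly_lt ha hc hirr hp

/-- **`ρ_G(p^k) ≤ B_G` uniformly in prime powers** (the tree's Nagell-type bound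
`exists_polyRootCountMod_prime_pow_le` for the irreducible `G`). [folklore] -/
theorem exists_rhoG_primePow_le (ha : 0 < a) (hirr : Irreducible (quadPoly a b c)) :
    ∃ B : ℕ, 1 ≤ B ∧ ∀ p : ℕ, p.Prime → ∀ k : ℕ, rhoG a b c (p ^ k) ≤ B := by
  have hdeg : 0 < (quadPoly a b c).natDegree := by rw [natDegree_quadPoly ha.ne']; norm_num
  obtain ⟨M, hM1, hM⟩ :=
    Literature.NumberTheory.Sieve.exists_polyRootCountMod_prime_pow_le hirr hdeg
  refine ⟨(quadPoly a b c).natDegree * M, ?_, fun p hp k => hM p hp k⟩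
  rw [natDegree_quadPoly ha.ne']; omega

/-- Inner geometric tail: `∑_{2 ≤ k ≤ A} ρ_G(p^k)/p^k ≤ 2B/p²` for a prime `p`, if `ρ_G(p^k) ≤ B`.
[folklore] -/
theorem sum_rhoG_primePow_div_le {B : ℕ} (hB : ∀ p : ℕ, p.Prime → ∀ k : ℕ, rhoG a b c (p ^ k) ≤ B)
    {p : ℕ} (hp : p.Prime) (A : ℕ) :
    ∑ k ∈ Finset.Icc 2 A, (rhoGArith a b c (p ^ k)) / (p : ℝ) ^ k ≤ 2 * B / (p : ℝ) ^ 2 := by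
  have hp2 : (2 : ℝ) ≤ p := by exact_mod_cast hp.two_le
  have hp0 : (0 : ℝ) < p := by linarith
  have h1 : ∀ k ∈ Finset.Icc 2 A, (rhoGArith a b c (p ^ k)) / (p : ℝ) ^ k ≤
      (B : ℝ) * ((p : ℝ)⁻¹) ^ k := by
    intro k _
    have hρ : (rhoG a b c (p ^ k) : ℝ) ≤ B := by exact_mod_cast hB p hp k
    rw [rhoGArith_apply, inv_pow, div_eq_mul_inv]
    exact mul_le_mul_of_nonneg_right hρ (by positivity)
  refine (Finset.sum_le_sum h1).trans ?_
  rw [← Finset.mul_sum]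
  set r : ℝ := (p : ℝ)⁻¹ with hr
  have hr0 : 0 ≤ r := by positivity
  have hr1 : r ≤ 1 / 2 := by rw [hr, inv_le_comm₀ hp0 (by norm_num)]; norm_num; exact_mod_cast hp2
  have hgeom : ∑ k ∈ Finset.Icc 2 A, r ^ k ≤ 2 * r ^ 2 := by
    have hsub : Finset.Icc 2 A ⊆ Finset.range (A + 1) := fun k hk => by
      rw [Finset.mem_Icc] at hk; rw [Finset.mem_range]; omega
    have hsplit : ∑ k ∈ Finset.Icc 2 A, r ^ k = ∑ k ∈ Finset.range (A + 1), r ^ k -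
        ∑ k ∈ Finset.range (A + 1) \ Finset.Icc 2 A, r ^ k := by
      rw [← Finset.sum_sdiff hsub]; ring
    have hge : (1 : ℝ) + r ≤ ∑ k ∈ Finset.range (A + 1) \ Finset.Icc 2 A, r ^ k ∨ A < 2 := by
      by_cases hA : 2 ≤ A
      · left
        have h01 : ({0, 1} : Finset ℕ) ⊆ Finset.range (A + 1) \ Finset.Icc 2 A := by
          intro k hk
          rw [Finset.mem_insert, Finset.mem_singleton] at hk
          rw [Finset.mem_sdiff, Finset.mem_range, Finset.mem_Icc]
          rcases hk with rfl | rfl <;> omega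
        calc (1 : ℝ) + r = ∑ k ∈ ({0, 1} : Finset ℕ), r ^ k := by simp
          _ ≤ _ := Finset.sum_le_sum_of_subset_of_nonneg h01 fun _ _ _ => by positivity
      · right; omega
    rcases hge with hge | hA
    · have htot : ∑ k ∈ Finset.range (A + 1), r ^ k ≤ 1 / (1 - r) := by
        have := geom_sum_Ico_le_of_lt_one hr0 (by linarith : r < 1) (m := 0) (n := A + 1)
        simpa using this
      rw [hsplit]
      have h2 : 1 / (1 - r) ≤ 1 + r + 2 * r ^ 2 := by
        rw [div_le_iff₀ (by linarith)]; nlinarith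
      linarith
    · rw [Finset.Icc_eq_empty (by omega)]; simp; positivity
  have hB0 : (0 : ℝ) ≤ B := Nat.cast_nonneg _
  calc (B : ℝ) * ∑ k ∈ Finset.Icc 2 A, r ^ k ≤ B * (2 * r ^ 2) :=
        mul_le_mul_of_nonneg_left hgeom hB0
    _ = 2 * B / (p : ℝ) ^ 2 := by rw [hr, inv_pow]; ring

/-- **Condition (2) of Lemma 2 for `ω = ρ_G`**: there is `L_c = L_c(G) ≥ 1` with
`∑_{w ≤ p < z} ∑_{2 ≤ k ≤ A} ρ_G(p^k)/p^k ≤ L_c / log(3w)` for `2 ≤ w < z` and every `A`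
(`L_c = 3 B_G`: `∑_{p ≥ w} 2B/p² ≤ 4B/w` and `log 3w ≤ 1.5 w`). [cite: IwaniecActaArith1980b, §1 (2)] -/
theorem rhoG_condition_two (ha : 0 < a) (hirr : Irreducible (quadPoly a b c)) :
    ∃ Lc : ℝ, 1 ≤ Lc ∧ ∀ w z : ℝ, 2 ≤ w → w < z → ∀ A : ℕ,
      ∑ p ∈ (Nat.primesBelow ⌈z⌉₊).filter (fun p : ℕ => w ≤ (p : ℝ)),
        ∑ k ∈ Finset.Icc 2 A, rhoGArith a b c (p ^ k) / (p : ℝ) ^ k ≤ Lc / Real.log (3 * w) := by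
  obtain ⟨B, hB1, hB⟩ := exists_rhoG_primePow_le ha hirr
  have hB1' : (1 : ℝ) ≤ B := by exact_mod_cast hB1
  refine ⟨6 * B, by linarith, fun w z hw _hwz A => ?_⟩
  set S := (Nat.primesBelow ⌈z⌉₊).filter (fun p : ℕ => w ≤ (p : ℝ)) with hS
  have h1 : ∑ p ∈ S, ∑ k ∈ Finset.Icc 2 A, rhoGArith a b c (p ^ k) / (p : ℝ) ^ k ≤
      ∑ p ∈ S, (B / 2 : ℝ) * (4 / (p : ℝ) ^ 2) := by
    refine Finset.sum_le_sum fun p hp => ?_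
    have h := sum_rhoG_primePow_div_le hB (Nat.mem_primesBelow.mp (Finset.mem_filter.mp hp).1).2 A
    calc _ ≤ 2 * (B : ℝ) / (p : ℝ) ^ 2 := h
      _ = (B / 2 : ℝ) * (4 / (p : ℝ) ^ 2) := by ring
  refine h1.trans ?_
  rw [← Finset.mul_sum]
  have h8 := sum_four_div_sq_le (z := z) hw
  have hw0 : 0 < w := by linarith
  -- `log(3w) ≤ 2 + (w − 1) ≤ 1.5 w`
  have hlog3 : Real.log 3 ≤ 2 := by
    have := Real.log_le_sub_one_of_pos (show (0 : ℝ) < 3 by norm_num); linarith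
  have hlogw : Real.log (3 * w) ≤ 3 / 2 * w := by
    rw [Real.log_mul (by norm_num) hw0.ne']
    have := Real.log_le_sub_one_of_pos hw0
    linarith
  have hlogpos : 0 < Real.log (3 * w) := Real.log_pos (by linarith)
  calc (B / 2 : ℝ) * ∑ p ∈ S, 4 / (p : ℝ) ^ 2 ≤ (B / 2 : ℝ) * (8 / w) :=
        mul_le_mul_of_nonneg_left h8 (by positivity)
    _ = 4 * B / w := by ring
    _ ≤ 6 * B / Real.log (3 * w) := by
        rw [div_le_div_iff₀ hw0 hlogpos]
        nlinarith


/-! ### `Λ₀ = lim V_G(t) log t = 2Γ_G e^{−γ} > 0`, and uniform closeness beyond `x^α` -/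

/-- `Λ₀(G) = 2Γ_G e^{−γ}`, the limit of `V_G(t) log t` (`tendsto_densityProdG_mul_log'`).
[folklore] -/
def lambda0G (a b c : ℤ) : ℝ := 2 * gammaG a b c * Real.exp (-Real.eulerMascheroniConstant)

/-- `Λ₀(G) > 0`. [folklore] -/
theorem lambda0G_pos (ha : 0 < a) (hc : Odd c) (hirr : Irreducible (quadPoly a b c)) :
    0 < lambda0G a b c := by
  unfold lambda0G
  have := gammaG_pos ha hc hirr
  positivity

/-- **Uniform closeness**: for `δ > 0`, `α > 0` and all large `x`, `|V_G(t) log t − Λ₀| ≤ δ` for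
every `t ≥ x^α` (p. 186: "`V(Z) = V(z)(log z/log z_q)(1 + O(1/log z))`", qualitative form).
[cite: IwaniecInventiones1978, §5 p. 186] -/
theorem eventually_forall_abs_densityProdG_mul_log_sub_le (ha : 0 < a) (hc : Odd c)
    (hirr : Irreducible (quadPoly a b c)) {δ α : ℝ} (hδ : 0 < δ) (hα : 0 < α) :
    ∀ᶠ x : ℝ in atTop, ∀ t : ℝ, x ^ α ≤ t →
      |densityProdG a b c t * Real.log t - lambda0G a b c| ≤ δ := by
  have h := tendsto_densityProdG_mul_log' ha hc hirr
  have h1 : ∀ᶠ t : ℝ in atTop, |densityProdG a b c t * Real.log t - lambda0G a b c| ≤ δ := by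
    have := (Metric.tendsto_nhds.mp h) δ hδ
    filter_upwards [this] with t ht
    rw [Real.dist_eq] at ht
    exact ht.le
  obtain ⟨T, hT⟩ := eventually_atTop.mp h1
  filter_upwards [(tendsto_rpow_atTop hα).eventually_ge_atTop T] with x hx t ht
  exact hT t (hx.trans ht)

/-- The two-sided form: for large `x` and `t ≥ x^α`, `Λ₀/2 ≤ V_G(t) log t ≤ 2Λ₀`. [folklore] -/
theorem eventually_forall_densityProdG_mul_log_mem (ha : 0 < a) (hc : Odd c)
    (hirr : Irreducible (quadPoly a b c)) {α : ℝ} (hα : 0 < α) :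
    ∀ᶠ x : ℝ in atTop, ∀ t : ℝ, x ^ α ≤ t →
      lambda0G a b c / 2 ≤ densityProdG a b c t * Real.log t ∧
        densityProdG a b c t * Real.log t ≤ 2 * lambda0G a b c := by
  have hΛ := lambda0G_pos ha hc hirr
  filter_upwards [eventually_forall_abs_densityProdG_mul_log_sub_le ha hc hirr (half_pos hΛ) hα]
    with x hx t ht
  have h := hx t ht
  rw [abs_le] at h
  constructor <;> linarith [h.1, h.2]

/-! ### `ρ_G(q) = 0` forces `S(𝒜_q, u) = 0` -/

/-- If `ρ_G(q) = 0` then no `|G(n)|` is divisible by `q` (`G` without integer roots, for the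
degenerate `q = 0`). [folklore] -/
theorem not_dvd_of_rhoG_eq_zero (ha : a ≠ 0) (hirr : Irreducible (quadPoly a b c)) {q : ℕ}
    (hq : rhoG a b c q = 0) (n : ℕ) : ¬ q ∣ gAbs a b c n := by
  intro hdvd
  rcases Nat.eq_zero_or_pos q with rfl | hq0
  · rw [zero_dvd_iff, gAbs, Int.natAbs_eq_zero] at hdvd
    exact quadPoly_eval_ne_zero ha hirr n hdvd
  have hd : (q : ℤ) ∣ a * (n : ℤ) ^ 2 + b * n + c := by
    have := Int.natCast_dvd_natCast.mpr hdvd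
    rwa [gAbs, Int.natCast_natAbs, dvd_abs] at this
  have hmod : ((n % q : ℕ) : ℤ) ≡ (n : ℤ) [ZMOD q] := by
    rw [Int.ModEq, Int.natCast_mod]
    exact Int.emod_emod_of_dvd _ (dvd_refl _)
  have hpoly : a * ((n % q : ℕ) : ℤ) ^ 2 + b * ((n % q : ℕ) : ℤ) + c ≡
      a * (n : ℤ) ^ 2 + b * n + c [ZMOD q] :=
    (((hmod.pow 2).mul_left a).add (hmod.mul_left b)).add_right c
  have hd' : (q : ℤ) ∣ a * ((n % q : ℕ) : ℤ) ^ 2 + b * ((n % q : ℕ) : ℤ) + c := by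
    have h1 := hpoly.symm.dvd
    have h2 := dvd_add h1 hd
    rwa [sub_add_cancel] at h2
  have hmem : n % q ∈ (Finset.range q).filter fun ν : ℕ =>
      (q : ℤ) ∣ ∏ i, (![quadPoly a b c] i).eval (ν : ℤ) := by
    rw [Finset.mem_filter, Finset.mem_range]
    refine ⟨Nat.mod_lt n hq0, ?_⟩
    simp only [Fin.prod_univ_one, Matrix.cons_val_fin_one, eval_quadPoly]
    exact hd'
  unfold rhoG polyRootCountMod at hq
  rw [Finset.card_eq_zero] at hq
  rw [hq] at hmem
  exact absurd hmem (Finset.notMem_empty _)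

open scoped Classical in
/-- `ρ_G(q) = 0 ⟹ S(𝒜_q, u) = 0`. [folklore] -/
theorem siftedCountG_eq_zero_of_rhoG_eq_zero (ha : a ≠ 0) (hirr : Irreducible (quadPoly a b c))
    (x : ℝ) {q : ℕ} (hq : rhoG a b c q = 0) (u : ℝ) : siftedCountG a b c x q u = 0 := by
  unfold siftedCountG
  rw [Finset.card_eq_zero, Finset.filter_eq_empty_iff]
  intro n _ h
  exact not_dvd_of_rhoG_eq_zero ha hirr hq n h.1

/-! ### Sums of `ρ_G(q)/q` over `x^γ`-rough `q < x` are `O_{γ,G}(1)` -/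

/-- `g(d) = ρ_G(d)/d` as a real arithmetic function. [folklore] -/
def rhoGDivArith (a b c : ℤ) : ArithmeticFunction ℝ :=
  ⟨fun n => (rhoG a b c n : ℝ) / n, by simp [rhoG_zero]⟩

/-- `rhoGDivArith n = ρ_G(n)/n`. [folklore] -/
@[simp] theorem rhoGDivArith_apply (n : ℕ) : rhoGDivArith a b c n = (rhoG a b c n : ℝ) / n := rfl

/-- `ρ_G(d)/d` is multiplicative. [folklore] -/
theorem isMultiplicative_rhoGDivArith :
    ArithmeticFunction.IsMultiplicative (rhoGDivArith a b c) := by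
  refine ⟨by simp [rhoG_one], fun {m n} h => ?_⟩
  have hm := (isMultiplicative_rhoGArith (a := a) (b := b) (c := c)).map_mul_of_coprime h
  simp only [rhoGArith_apply] at hm
  simp only [rhoGDivArith_apply, hm, Nat.cast_mul]
  rw [div_mul_div_comm]

/-- `∑_{k ≤ A} ρ_G(p^k)/p^k ≤ 1 + ρ_G(p)/p + 2B/p²` for a prime `p`, if `ρ_G(p^k) ≤ B`. [folklore] -/
theorem sum_range_rhoGDivArith_primePow_le {B : ℕ}
    (hB : ∀ p : ℕ, p.Prime → ∀ k : ℕ, rhoG a b c (p ^ k) ≤ B) {p : ℕ} (hp : p.Prime) (A : ℕ) :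
    ∑ k ∈ Finset.range (A + 1), rhoGDivArith a b c (p ^ k) ≤
      1 + (rhoG a b c p : ℝ) / p + 2 * B / (p : ℝ) ^ 2 := by
  have hsplit : Finset.range (A + 1) = {0, 1} ∪ Finset.Icc 2 A ∨ A = 0 := by
    rcases Nat.eq_zero_or_pos A with h | h
    · exact Or.inr h
    · left; ext k; simp only [Finset.mem_range, Finset.mem_union, Finset.mem_insert,
        Finset.mem_singleton, Finset.mem_Icc]; omega
  have hp0 : (0 : ℝ) < p := by exact_mod_cast hp.pos
  have h4 : 0 ≤ 2 * (B : ℝ) / (p : ℝ) ^ 2 := by positivity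
  have hρ : 0 ≤ (rhoG a b c p : ℝ) / p := by positivity
  rcases hsplit with hsplit | hA
  · rw [hsplit, Finset.sum_union]
    · have h01 : ∑ k ∈ ({0, 1} : Finset ℕ), rhoGDivArith a b c (p ^ k) =
          1 + (rhoG a b c p : ℝ) / p := by
        rw [Finset.sum_pair (by norm_num)]
        simp [rhoG_one]
      rw [h01]
      have htail := sum_rhoG_primePow_div_le hB hp A
      have heq : ∑ k ∈ Finset.Icc 2 A, rhoGDivArith a b c (p ^ k) =
          ∑ k ∈ Finset.Icc 2 A, rhoGArith a b c (p ^ k) / (p : ℝ) ^ k := by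
        refine Finset.sum_congr rfl fun k _ => ?_
        simp [rhoGDivArith_apply, rhoGArith_apply]
      rw [heq]
      linarith
    · rw [Finset.disjoint_left]
      intro k hk
      simp only [Finset.mem_insert, Finset.mem_singleton] at hk
      simp only [Finset.mem_Icc]; omega
  · subst hA
    simp [rhoG_one]
    linarith

/-- **The sum of `ρ_G(q)/q` over the `x^γ`-rough integers `q < x` is `O_{γ,G}(1)`**: there is a
constant `B_γ = B_γ(G)` with `∑_{q ∈ T} ρ_G(q)/q ≤ B_γ` for all large `x` and every finite set `T`
of integers `1 ≤ q < x` coprime to `P(x^γ)` (each `q` divides `∏_{x^γ ≤ p < x} p^A`, and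
`∑_{d ∣ N} ρ_G(d)/d = ∏ ∑_k ρ_G(p^k)/p^k ≤ exp ∑ (ρ_G(p)/p + 2B/p²)`, with the tail form of
Mertens II for `ρ_G`, `exists_sum_rhoG_div_filter_le`).  This bounds the factor
`∑ c_q ρ_G(q)/q` implicit in the `O_γ(ε)` of Proposition 2. [cite: IwaniecInventiones1978, §5 p. 186] -/
theorem eventually_sum_rough_rhoG_div_le (ha : 0 < a) (hc : Odd c)
    (hirr : Irreducible (quadPoly a b c)) {γ : ℝ} (hγ : 0 < γ) (hγ1 : γ < 1) :
    ∃ Bγ : ℝ, 0 < Bγ ∧ ∀ᶠ x : ℝ in atTop, ∀ T : Finset ℕ,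
      (∀ q ∈ T, 1 ≤ q ∧ (q : ℝ) < x ∧ q.Coprime (primesProdBelow (x ^ γ))) →
        ∑ q ∈ T, (rhoG a b c q : ℝ) / q ≤ Bγ := by
  obtain ⟨C₂, hC₂⟩ := exists_sum_rhoG_div_filter_le ha hc hirr
  obtain ⟨B, hB1, hB⟩ := exists_rhoG_primePow_le ha hirr
  refine ⟨Real.exp (2 + B) / γ, by positivity, ?_⟩
  -- largeness conditions: `x^γ ≥ 2`, `x^γ < x`, `C₂/(γ log x) ≤ 1`, `8/x^γ ≤ 1`
  have hev1 : ∀ᶠ x : ℝ in atTop, 2 ≤ x ^ γ := (tendsto_rpow_atTop hγ).eventually_ge_atTop 2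
  have hev2 : ∀ᶠ x : ℝ in atTop, C₂ / (γ * Real.log x) ≤ 1 := by
    have : Tendsto (fun x : ℝ => C₂ / (γ * Real.log x)) atTop (𝓝 0) :=
      tendsto_const_nhds.div_atTop (Real.tendsto_log_atTop.const_mul_atTop hγ)
    exact (this.eventually (ge_mem_nhds one_pos)).mono fun x hx => hx
  have hev3 : ∀ᶠ x : ℝ in atTop, 8 / x ^ γ ≤ 1 := by
    have : Tendsto (fun x : ℝ => 8 / x ^ γ) atTop (𝓝 0) :=
      tendsto_const_nhds.div_atTop (tendsto_rpow_atTop hγ)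
    exact (this.eventually (ge_mem_nhds one_pos)).mono fun x hx => hx
  filter_upwards [hev1, hev2, hev3, eventually_gt_atTop (1 : ℝ)] with x hx1 hx2 hx3 hx T hT
  have hx0 : 0 < x := by linarith
  have hxγ : x ^ γ < x := by
    conv_rhs => rw [← Real.rpow_one x]
    exact Real.rpow_lt_rpow_of_exponent_lt hx hγ1
  -- the primes `x^γ ≤ p < x` and the modulus `Nbig`
  set S := (Nat.primesBelow ⌈x⌉₊).filter (fun p : ℕ => x ^ γ ≤ (p : ℝ)) with hS
  set A : ℕ := ⌈x⌉₊ with hA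
  set Nbig : ℕ := ∏ p ∈ S, p ^ A with hNbig
  have hSprime : ∀ p ∈ S, p.Prime := fun p hp => (Nat.mem_primesBelow.mp (Finset.mem_filter.mp hp).1).2
  have hNbig0 : Nbig ≠ 0 := Finset.prod_ne_zero_iff.mpr fun p hp => pow_ne_zero _ (hSprime p hp).ne_zero
  -- every `q ∈ T` divides `Nbig`
  have hdvd : ∀ q ∈ T, q ∣ Nbig := by
    intro q hq
    obtain ⟨hq1, hqx, hcop⟩ := hT q hq
    have hq0 : q ≠ 0 := by omega
    have hPF : q.primeFactors ⊆ S := by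
      intro p hp
      have hpp := Nat.prime_of_mem_primeFactors hp
      have hpq : p ∣ q := Nat.dvd_of_mem_primeFactors hp
      rw [hS, Finset.mem_filter, Nat.mem_primesBelow]
      refine ⟨⟨?_, hpp⟩, ?_⟩
      · have : (p : ℝ) < x := lt_of_le_of_lt (by exact_mod_cast Nat.le_of_dvd (by omega) hpq) hqx
        exact Nat.lt_ceil.mpr this
      · by_contra hlt
        push Not at hlt
        have hpP : p ∣ primesProdBelow (x ^ γ) := by
          unfold primesProdBelow
          exact Finset.dvd_prod_of_mem _ (Nat.mem_primesBelow.mpr ⟨Nat.lt_ceil.mpr hlt, hpp⟩)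
        have h1 : p ∣ Nat.gcd q (primesProdBelow (x ^ γ)) := Nat.dvd_gcd hpq hpP
        rw [hcop] at h1
        exact hpp.not_dvd_one h1
    rw [Nat.prod_primeFactors_pow_factorization hq0]
    calc ∏ p ∈ q.primeFactors, p ^ q.factorization p ∣ ∏ p ∈ q.primeFactors, p ^ A := by
          refine Finset.prod_dvd_prod_of_dvd _ _ fun p hp => pow_dvd_pow p ?_
          have hpp := Nat.prime_of_mem_primeFactors hp
          have h1 : p ^ q.factorization p ≤ q := Nat.le_of_dvd (by omega) (Nat.ordProj_dvd q p)
          have h2 : q.factorization p < p ^ q.factorization p := Nat.lt_pow_self hpp.one_lt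
          have h3 : q ≤ A := by
            rw [hA]; exact_mod_cast (hqx.le.trans (Nat.le_ceil x))
          omega
      _ ∣ Nbig := Finset.prod_dvd_prod_of_subset _ _ _ hPF
  -- `T ⊆ divisors Nbig`
  have hTsub : T ⊆ Nbig.divisors := fun q hq => Nat.mem_divisors.mpr ⟨hdvd q hq, hNbig0⟩
  have hstep1 : ∑ q ∈ T, (rhoG a b c q : ℝ) / q ≤ ∑ d ∈ Nbig.divisors, rhoGDivArith a b c d := by
    calc ∑ q ∈ T, (rhoG a b c q : ℝ) / q = ∑ q ∈ T, rhoGDivArith a b c q := by simp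
      _ ≤ ∑ d ∈ Nbig.divisors, rhoGDivArith a b c d :=
          Finset.sum_le_sum_of_subset_of_nonneg hTsub fun d _ _ => by
            rw [rhoGDivArith_apply]; positivity
  -- multiplicativity: `∑_{d ∣ Nbig} g(d) = ∏_{p ∈ S} ∑_{k ≤ A} g(p^k)`
  have hmult : (rhoGDivArith a b c *
      (ArithmeticFunction.zeta : ArithmeticFunction ℝ)).IsMultiplicative :=
    isMultiplicative_rhoGDivArith.mul ArithmeticFunction.isMultiplicative_zeta.natCast
  have hstep2 : ∑ d ∈ Nbig.divisors, rhoGDivArith a b c d =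
      ∏ p ∈ S, ∑ k ∈ Finset.range (A + 1), rhoGDivArith a b c (p ^ k) := by
    rw [← ArithmeticFunction.coe_mul_zeta_apply, hNbig]
    rw [hmult.map_prod (fun p : ℕ => p ^ A) S ?_]
    · refine Finset.prod_congr rfl fun p hp => ?_
      rw [ArithmeticFunction.coe_mul_zeta_apply, Nat.sum_divisors_prime_pow (hSprime p hp)]
    · intro p hp p' hp' hne
      exact (Nat.coprime_pow_primes _ _ (hSprime p hp) (hSprime p' hp') hne)
  -- each factor `≤ 1 + ρ_G(p)/p + 2B/p² ≤ exp(ρ_G(p)/p + 2B/p²)`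
  have hstep3 : ∏ p ∈ S, ∑ k ∈ Finset.range (A + 1), rhoGDivArith a b c (p ^ k) ≤
      Real.exp (∑ p ∈ S, ((rhoG a b c p : ℝ) / p + 2 * B / (p : ℝ) ^ 2)) := by
    rw [Real.exp_sum]
    refine Finset.prod_le_prod (fun p _ => Finset.sum_nonneg fun k _ => by
      rw [rhoGDivArith_apply]; positivity) fun p hp => ?_
    refine (sum_range_rhoGDivArith_primePow_le hB (hSprime p hp) A).trans ?_
    have := Real.add_one_le_exp ((rhoG a b c p : ℝ) / p + 2 * B / (p : ℝ) ^ 2)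
    linarith
  -- the exponent is at most `log(1/γ) + 1 + B/2`
  have hlogx : 0 < Real.log x := Real.log_pos hx
  have hB0 : (0 : ℝ) ≤ B := Nat.cast_nonneg _
  have hstep4 : ∑ p ∈ S, ((rhoG a b c p : ℝ) / p + 2 * B / (p : ℝ) ^ 2) ≤
      Real.log (1 / γ) + (2 + B) := by
    rw [Finset.sum_add_distrib]
    have hA' := hC₂ (x ^ γ) x hx1 hxγ
    have hB' := sum_four_div_sq_le (z := x) hx1
    have hlogxγ : Real.log (x ^ γ) = γ * Real.log x := Real.log_rpow hx0 γ
    rw [hlogxγ] at hA'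
    have h1 : Real.log (Real.log x / (γ * Real.log x)) = Real.log (1 / γ) := by
      congr 1; field_simp
    rw [h1] at hA'
    have h2 : ∑ p ∈ S, 2 * (B : ℝ) / (p : ℝ) ^ 2 = (B / 2 : ℝ) * ∑ p ∈ S, 4 / (p : ℝ) ^ 2 := by
      rw [Finset.mul_sum]; exact Finset.sum_congr rfl fun p _ => by ring
    rw [h2]
    have h3 : (B / 2 : ℝ) * ∑ p ∈ S, 4 / (p : ℝ) ^ 2 ≤ (B / 2 : ℝ) * 1 :=
      mul_le_mul_of_nonneg_left (hB'.trans hx3) (by positivity)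
    linarith
  calc ∑ q ∈ T, (rhoG a b c q : ℝ) / q ≤ ∑ d ∈ Nbig.divisors, rhoGDivArith a b c d := hstep1
    _ = ∏ p ∈ S, ∑ k ∈ Finset.range (A + 1), rhoGDivArith a b c (p ^ k) := hstep2
    _ ≤ Real.exp (∑ p ∈ S, ((rhoG a b c p : ℝ) / p + 2 * B / (p : ℝ) ^ 2)) := hstep3
    _ ≤ Real.exp (Real.log (1 / γ) + (2 + B)) := Real.exp_le_exp.mpr hstep4
    _ = Real.exp (2 + B) / γ := by
        rw [Real.exp_add, Real.exp_log (by positivity)]; ring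

/-! ### Lemma 2 applied to `ℬ = 𝒜_q` with `X = ρ_G(q) x / q`, `ω = ρ_G` -/

/-- **Lemma 2 for `ℬ = 𝒜_q`, `𝒜 = 𝒜_G`** (p. 185: "for each `q` from `H(Q, Z)` we apply Lemma 2
to the sequence `ℬ = 𝒜_q` with the parameter `X = ρ(q) x/q` as to have
`r(ℬ, d) = r(𝒜_q, d) = r(𝒜, qd)` for all `d ∣ P(Z)`"): given `lemma2_bilinearSieve` — conditions
(1), (2) for `ω = ρ_G` being PROVED (`rhoG_sieveConditionOne`, `rhoG_condition_two`) — for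
`q ≥ 1` with `ρ_G(q) > 0`, `2 ≤ u ≤ (MN)^{1/2}` and `(q, P(u)) = 1`:
`S(𝒜_q, u) ≤ V_G(u) X {F(s) + E} + R⁺`, `S(𝒜_q, u) ≥ V_G(u) X {f(s) − E} − R⁻` with
`s = log MN / log u`, `E = c₀(ε + ε⁻⁸ e^{K+L_c} (log MN)^{−1/3})` and
`R^± = ∑_{l<L} ∑_{m<M} ∑_{n<N, mn ∣ P(u)} a^±_{l,m} b^±_{l,n} r(𝒜; qmn)`, the coefficients
depending on `M, N, ε` (and `F, f`) only. [cite: IwaniecInventiones1978, §5 p. 185, (21)] -/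
theorem lemma2_multisetAqG (h2 : lemma2_bilinearSieve) (ha : 0 < a) (hc : Odd c)
    (hirr : Irreducible (quadPoly a b c)) :
    ∃ c₀ K Lc : ℝ, 0 < c₀ ∧ 1 ≤ K ∧ 1 ≤ Lc ∧
    ∀ (F f : ℝ → ℝ), IsLinearSieveFunctions F f →
    ∀ (ε M N : ℝ), 0 < ε → ε < 1 / 3 → 1 < M → 1 < N →
      ∃ (L : ℕ) (au bu al bl : ℕ → ℕ → ℝ),
        (L : ℝ) ≤ Real.exp (8 * ε⁻¹ ^ 3) ∧
        (∀ l m, |au l m| ≤ 1) ∧ (∀ l n, |bu l n| ≤ 1) ∧ (∀ l m, |al l m| ≤ 1) ∧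
        (∀ l n, |bl l n| ≤ 1) ∧
        ∀ (x : ℝ) (q : ℕ), 0 < x → 0 < q → 0 < rhoG a b c q →
          ∀ u : ℝ, 2 ≤ u → u ≤ (M * N) ^ (1 / 2 : ℝ) → q.Coprime (primesProdBelow u) →
            let X : ℝ := (rhoG a b c q : ℝ) * x / q
            let s : ℝ := Real.log (M * N) / Real.log u
            let E : ℝ := c₀ * (ε + ε⁻¹ ^ 8 * Real.exp (K + Lc) * Real.log (M * N) ^ (-(1 / 3 : ℝ)))
            let R : (ℕ → ℕ → ℝ) → (ℕ → ℕ → ℝ) → ℝ := fun ac bc =>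
              ∑ l ∈ Finset.range L, ∑ m ∈ Finset.Ico 1 ⌈M⌉₊, ∑ n ∈ Finset.Ico 1 ⌈N⌉₊,
                if m * n ∣ primesProdBelow u then ac l m * bc l n * remG a b c x (q * (m * n)) else 0
            (siftedCountG a b c x q u : ℝ) ≤ densityProdG a b c u * X * (F s + E) + R au bu ∧
              densityProdG a b c u * X * (f s - E) - R al bl ≤ (siftedCountG a b c x q u : ℝ) := by
  obtain ⟨c₀, hc₀, H⟩ := h2
  obtain ⟨K, hK1, hKc⟩ := rhoG_sieveConditionOne ha hc hirr
  obtain ⟨Lc, hLc1, hLc⟩ := rhoG_condition_two ha hirr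
  refine ⟨c₀, K, Lc, hc₀, hK1, hLc1, fun F f hFf ε M N hε hε3 hM hN => ?_⟩
  obtain ⟨L, au, bu, al, bl, hL, hau, hbu, hal, hbl, H2⟩ := H F f hFf ε M N hε hε3 hM hN
  refine ⟨L, au, bu, al, bl, hL, hau, hbu, hal, hbl, fun x q hx hq hρ u hu2 huMN hcop => ?_⟩
  dsimp only
  have hρ' : (0 : ℝ) < rhoG a b c q := by exact_mod_cast hρ
  have hq' : (0 : ℝ) < q := by exact_mod_cast hq
  have hX : 0 < (rhoG a b c q : ℝ) * x / q := by positivity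
  have cond1 : ∀ w z : ℝ, 2 ≤ w → w < z →
      ∏ p ∈ (Nat.primesBelow ⌈z⌉₊).filter (fun p : ℕ => w ≤ (p : ℝ)), (1 - rhoGArith a b c p / p)⁻¹ ≤
        Real.log z / Real.log w * (1 + K / Real.log w) := fun w z hw hwz => hKc w z hw hwz
  have cond2 : ∀ w z : ℝ, 2 ≤ w → w < z → ∀ A : ℕ,
      ∑ p ∈ (Nat.primesBelow ⌈z⌉₊).filter (fun p : ℕ => w ≤ (p : ℝ)),
        ∑ k ∈ Finset.Icc 2 A, rhoGArith a b c (p ^ k) / (p : ℝ) ^ k ≤ Lc / Real.log (3 * w) :=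
    fun w z hw hwz A => hLc w z hw hwz A
  have H3 := H2 (multisetAqG a b c x q) ((rhoG a b c q : ℝ) * x / q) (rhoGArith a b c) K Lc hX
    isMultiplicative_rhoGArith rhoGArith_nonneg (fun p hp => rhoGArith_lt_prime ha hc hirr hp) hK1
    hLc1 cond1 cond2 u hu2 huMN
  dsimp only at H3
  rw [msifted_multisetAqG] at H3
  -- identify the remainder terms
  have hr : ∀ m ∈ Finset.Ico 1 ⌈M⌉₊, ∀ n ∈ Finset.Ico 1 ⌈N⌉₊, m * n ∣ primesProdBelow u →
      (mcount (multisetAqG a b c x q) (m * n) : ℝ) - rhoGArith a b c (m * n) / ((m * n : ℕ) : ℝ) *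
        ((rhoG a b c q : ℝ) * x / q) = remG a b c x (q * (m * n)) := by
    intro m hm n hn hmn
    have hm0 : m ≠ 0 := by have := (Finset.mem_Ico.mp hm).1; omega
    have hn0 : n ≠ 0 := by have := (Finset.mem_Ico.mp hn).1; omega
    have hcop' : q.Coprime (m * n) := Nat.Coprime.coprime_dvd_right hmn hcop
    rw [remG_mul_eq_of_coprime x hq.ne' (mul_ne_zero hm0 hn0) hcop', rhoGArith_apply]
  have hR : ∀ ac bc : ℕ → ℕ → ℝ,
      (∑ l ∈ Finset.range L, ∑ m ∈ Finset.Ico 1 ⌈M⌉₊, ∑ n ∈ Finset.Ico 1 ⌈N⌉₊,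
        if m * n ∣ primesProdBelow u then
          ac l m * bc l n * ((mcount (multisetAqG a b c x q) (m * n) : ℝ) -
            rhoGArith a b c (m * n) / ((m * n : ℕ) : ℝ) * ((rhoG a b c q : ℝ) * x / q)) else 0) =
      ∑ l ∈ Finset.range L, ∑ m ∈ Finset.Ico 1 ⌈M⌉₊, ∑ n ∈ Finset.Ico 1 ⌈N⌉₊,
        if m * n ∣ primesProdBelow u then ac l m * bc l n * remG a b c x (q * (m * n)) else 0 := by
    intro ac bc
    refine Finset.sum_congr rfl fun l _ => Finset.sum_congr rfl fun m hm =>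
      Finset.sum_congr rfl fun n hn => ?_
    split_ifs with hmn
    · rw [hr m hm n hn hmn]
    · rfl
  rw [hR au bu, hR al bl] at H3
  unfold densityProdG
  simpa only [rhoGArith_apply] using H3




/-! ### The remainder of a class: from Lemma 2's bilinear form to the level of distribution of `𝒜_G` -/

/-- **Rewriting one bilinear form of Lemma 2's remainder for `ℬ = 𝒜_q` through `B(x; qm, N)`**:
for `(q, P(u)) = 1` and coefficients `a, b`,
`∑_{m<M} ∑_{n<N} [mn ∣ P(u)] a_m b_n r(𝒜; qmn) = ∑_{m<M, m ∣ P(u)} a_m B(x; qm, N)` with the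
coefficients `b'_n = b_n [n ∣ P(u)]` inside `B` (p. 185, (21)). [cite: IwaniecInventiones1978, §5 (21)] -/
theorem remainder_eq_sum_bilinearBG (x u M N : ℝ) {q : ℕ} (hq : q.Coprime (primesProdBelow u))
    (ac bc : ℕ → ℝ) :
    ∑ m ∈ Finset.Ico 1 ⌈M⌉₊, ∑ n ∈ Finset.Ico 1 ⌈N⌉₊,
        (if m * n ∣ primesProdBelow u then ac m * bc n * remG a b c x (q * (m * n)) else 0) =
      ∑ m ∈ (Finset.Ico 1 ⌈M⌉₊).filter (fun m => m ∣ primesProdBelow u),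
        ac m * bilinearBG a b c x (fun n => if n ∣ primesProdBelow u then bc n else 0) (q * m) N := by
  rw [Finset.sum_filter]
  refine Finset.sum_congr rfl fun m _ => ?_
  by_cases hm : m ∣ primesProdBelow u
  · rw [if_pos hm, bilinearBG, Finset.sum_filter, Finset.mul_sum]
    refine Finset.sum_congr rfl fun n _ => ?_
    have hiff0 := mul_dvd_squarefree_iff (n := n) (squarefree_primesProdBelow u) hm
    by_cases hn : n ∣ primesProdBelow u
    · have hnq : n.Coprime q := (Nat.Coprime.coprime_dvd_right hn hq).symm
      have hiff : n.Coprime m ↔ n.Coprime (q * m) :=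
        ⟨fun h => Nat.Coprime.mul_right hnq h, fun h => Nat.Coprime.coprime_mul_left_right h⟩
      by_cases hnm : n.Coprime m
      · rw [if_pos (hiff0.mpr ⟨hn, hnm⟩), if_pos (hiff.mp hnm), if_pos hn, mul_assoc q m n]; ring
      · rw [if_neg (fun h => hnm (hiff0.mp h).2), if_neg (fun h => hnm (hiff.mpr h)), mul_zero]
    · rw [if_neg (fun h => hn (hiff0.mp h).1)]
      split_ifs <;> simp
  · rw [if_neg hm]
    refine Finset.sum_eq_zero fun n _ => ?_
    rw [if_neg (fun h => hm (dvd_trans (dvd_mul_right m n) h))]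

/-- **The remainder of a class is admissible for the Corollary of Proposition 1** (p. 186: "the
latter error term being estimated by means of Corollary of Proposition 1"): for a finite set `T`
of moduli `q`, all coprime to `P(u)` and with `q M ≤ x^{1−4ε'}`, and coefficients bounded by `1`,
`|∑_{q ∈ T} c_q ∑_{m<M} ∑_{n<N} [mn ∣ P(u)] a_m b_n r(𝒜; qmn)| ≤ ∑_{m' < x^{1−4ε'}} |B(x; m', N)|`
with `b'_n = b_n [n ∣ P(u)]` (the pairs `(q, m)` inject into `m' = qm`, `mul_injOn_rough_smooth`).
[cite: IwaniecInventiones1978, §5 p. 186] -/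
theorem abs_remainder_class_leG (x u M N D : ℝ) (T : Finset ℕ) (cc ac bc : ℕ → ℝ)
    (hT : ∀ q ∈ T, 0 < q ∧ q.Coprime (primesProdBelow u) ∧ (q : ℝ) * M ≤ D)
    (hcc : ∀ q, |cc q| ≤ 1) (hac : ∀ m, |ac m| ≤ 1) :
    |∑ q ∈ T, cc q * ∑ m ∈ Finset.Ico 1 ⌈M⌉₊, ∑ n ∈ Finset.Ico 1 ⌈N⌉₊,
        (if m * n ∣ primesProdBelow u then ac m * bc n * remG a b c x (q * (m * n)) else 0)| ≤
      ∑ m' ∈ Finset.Ico 1 ⌈D⌉₊,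
        |bilinearBG a b c x (fun n => if n ∣ primesProdBelow u then bc n else 0) m' N| := by
  classical
  set b' : ℕ → ℝ := fun n => if n ∣ primesProdBelow u then bc n else 0 with hb'
  set Mf := (Finset.Ico 1 ⌈M⌉₊).filter (fun m => m ∣ primesProdBelow u) with hMf
  set g : ℕ → ℝ := fun m' => |bilinearBG a b c x b' m' N| with hg
  -- rewrite through `B` and take absolute values inside
  have h1 : |∑ q ∈ T, cc q * ∑ m ∈ Finset.Ico 1 ⌈M⌉₊, ∑ n ∈ Finset.Ico 1 ⌈N⌉₊,
      (if m * n ∣ primesProdBelow u then ac m * bc n * remG a b c x (q * (m * n)) else 0)| ≤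
      ∑ q ∈ T, ∑ m ∈ Mf, g (q * m) := by
    refine (Finset.abs_sum_le_sum_abs _ _).trans (Finset.sum_le_sum fun q hq => ?_)
    rw [remainder_eq_sum_bilinearBG x u M N (hT q hq).2.1 ac bc, abs_mul]
    refine (mul_le_of_le_one_left (abs_nonneg _) (hcc q)).trans ?_
    refine (Finset.abs_sum_le_sum_abs _ _).trans (Finset.sum_le_sum fun m _ => ?_)
    rw [abs_mul]
    exact mul_le_of_le_one_left (abs_nonneg _) (hac m)
  refine h1.trans ?_
  -- the pairs `(q, m)` inject into `m' = q m < D`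
  rw [← Finset.sum_product (s := T) (t := Mf) (f := fun qm : ℕ × ℕ => g (qm.1 * qm.2))]
  have hinj : Set.InjOn (fun qm : ℕ × ℕ => qm.1 * qm.2) ↑(T ×ˢ Mf) := by
    refine (mul_injOn_rough_smooth u).mono fun qm hqm => ?_
    have h := Finset.mem_product.mp (Finset.mem_coe.mp hqm)
    exact ⟨(Finset.mem_filter.mp h.2).2, (hT qm.1 h.1).2.1⟩
  rw [← Finset.sum_image (g := fun qm : ℕ × ℕ => qm.1 * qm.2) (f := g) hinj]
  refine Finset.sum_le_sum_of_subset_of_nonneg (fun m' hm' => ?_) fun _ _ _ => abs_nonneg _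
  obtain ⟨⟨q, m⟩, hqm, rfl⟩ := Finset.mem_image.mp hm'
  obtain ⟨hq, hm⟩ := Finset.mem_product.mp hqm
  obtain ⟨hq0, -, hqM⟩ := hT q hq
  have hm1 : 1 ≤ m := (Finset.mem_Ico.mp (Finset.mem_filter.mp hm).1).1
  have hmM : m < ⌈M⌉₊ := (Finset.mem_Ico.mp (Finset.mem_filter.mp hm).1).2
  rw [Finset.mem_Ico]
  refine ⟨Nat.one_le_iff_ne_zero.mpr (mul_ne_zero hq0.ne' (by omega)), Nat.lt_ceil.mpr ?_⟩
  have hmM' : (m : ℝ) < M := by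
    have := Nat.lt_ceil.mp hmM
    exact_mod_cast this
  have hq' : (0 : ℝ) < q := by exact_mod_cast hq0
  push_cast
  calc (q : ℝ) * m < q * M := by gcongr
    _ ≤ D := hqM


/-! ### The main terms of a single `q`, generic in the density `V` and its limit `Λ₀` -/

set_option maxHeartbeats 800000 in
/-- **The main term of a single `q` in the proof of Proposition 2 (upper bound)** — generic in
the density function `V > 0` and its limit constant `Λ₀ > 0` (for `n² + 1`: `densityProd`,
`lambda0`; for a general `G`: `densityProdG`, `lambda0G`) — (p. 185 (21) and
p. 186: "`V(Z) = V(z)(log z/log z_q)(1 + O(1/log z))`" and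
"`F(log(y/Qx^{2ε})/log Z) = F(log(y/q)/log z_q) + O_γ(ε)`"), in explicit form.  With `L = log x`,
`z = x^γ`, sieving level `u = min(Z_c, (MN)^{1/2})` for a class floor `Z_c ≤ z_q < 2Z_c`,
`log MN ∈ [log(y/q) − 6ε'L, log(y/q)]`, and `Λ(t) = V(t) log t` within `εΛ₀/8` of `Λ₀` at
`t = u, z`: `V(u) F(log MN/log u) ≤ (V(z) log z/log z_q)(F(log(y/q)/log z_q) + C₃ ε)` with
`C₃ = 10(G_max + 4 L_G/γ)`, `G(s) = s F(s)`.  In the case `u = (MN)^{1/2}` both arguments lie in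
`(0, 3]`, where `s F(s) = A` is constant. [cite: IwaniecInventiones1978, §5 pp. 185–186] -/
theorem main_term_upper_gen {V : ℝ → ℝ} (hVpos : ∀ t, 0 < V t) {Λ₀ : ℝ} (hΛ₀ : 0 < Λ₀)
    {F f : ℝ → ℝ} (hFf : IsLinearSieveFunctions F f) {γ : ℝ} (hγ : 0 < γ)
    (hγ2 : γ < 1 / 2) {Lg : NNReal} {Gmax : ℝ}
    (hLip : LipschitzOnWith Lg (fun s : ℝ => s * F s) (Set.Icc (1 / 10) (16 / (15 * γ) + 2)))
    (hGmax : ∀ s ∈ Set.Icc (1 / 10 : ℝ) (16 / (15 * γ) + 2), |s * F s| ≤ Gmax)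
    {ε ε' x zq Zc MN u : ℝ} {q : ℕ} (hε : 0 < ε) (hε1 : ε ≤ 1) (hε' : 0 ≤ ε') (hε'ε : ε' ≤ ε / 1000)
    (hx : 1 < x) (hlogx : 1 / Real.log x ≤ ε * γ / 2)
    (hzq : x ^ γ ≤ zq ∧ zq < x ^ (1 / 2 : ℝ)) (hq : 1 ≤ q ∧ (q : ℝ) < x ^ (1 - ε))
    (hZc : Zc ≤ zq ∧ zq < 2 * Zc ∧ x ^ γ ≤ Zc) (hMN0 : 0 < MN)
    (hMN : Real.log (x ^ (16 / 15 : ℝ) / q) - 6 * ε' * Real.log x ≤ Real.log MN ∧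
      Real.log MN ≤ Real.log (x ^ (16 / 15 : ℝ) / q))
    (hu : u = min Zc (MN ^ (1 / 2 : ℝ)))
    (hΛu : |V u * Real.log u - Λ₀| ≤ ε / 8 * Λ₀)
    (hΛz : |V (x ^ γ) * Real.log (x ^ γ) - Λ₀| ≤ ε / 8 * Λ₀) :
    V u * F (Real.log MN / Real.log u) ≤
      V (x ^ γ) * Real.log (x ^ γ) / Real.log zq *
        (F (Real.log (x ^ (16 / 15 : ℝ) / q) / Real.log zq) + 10 * (Gmax + 4 * Lg / γ) * ε) := by
  -- notation and positivity
  have hx0 : 0 < x := by linarith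
  set L := Real.log x with hL
  have hL0 : 0 < L := Real.log_pos hx
  have hεL : 0 < ε * L := mul_pos hε hL0
  have hlz : Real.log (x ^ γ) = γ * L := Real.log_rpow hx0 γ
  have hγL : 0 < γ * L := mul_pos hγ hL0
  have hq0 : (0 : ℝ) < q := by exact_mod_cast hq.1
  have hq1 : (1 : ℝ) ≤ q := by exact_mod_cast hq.1
  set lyq := Real.log (x ^ (16 / 15 : ℝ) / q) with hlyq
  have hlyq_eq : lyq = 16 / 15 * L - Real.log q := by
    rw [hlyq, Real.log_div (by positivity) hq0.ne', Real.log_rpow hx0]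
  have hlogq0 : 0 ≤ Real.log q := Real.log_nonneg hq1
  have hlogq : Real.log q < (1 - ε) * L := by
    rw [← Real.log_rpow hx0]; exact Real.log_lt_log hq0 hq.2
  have hlyq_lo : L / 15 < lyq := by rw [hlyq_eq]; linarith
  have hlyq_hi : lyq ≤ 16 / 15 * L := by rw [hlyq_eq]; linarith
  have hlyq0 : 0 < lyq := lt_trans (by positivity) hlyq_lo
  have hzq0 : 0 < zq := lt_of_lt_of_le (Real.rpow_pos_of_pos hx0 γ) hzq.1
  set lzq := Real.log zq with hlzq
  have hlzq_lo : γ * L ≤ lzq := by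
    rw [← hlz]; exact Real.log_le_log (Real.rpow_pos_of_pos hx0 γ) hzq.1
  have hlzq_hi : lzq < L / 2 := by
    have := Real.log_lt_log hzq0 hzq.2
    rw [Real.log_rpow hx0] at this; linarith
  have hlzq0 : 0 < lzq := lt_of_lt_of_le hγL hlzq_lo
  set lMN := Real.log MN with hlMN
  have hε'L : 6 * ε' * L ≤ 90 * ε' * lyq := by
    have := mul_le_mul_of_nonneg_left (show L ≤ 15 * lyq by linarith) (show 0 ≤ 6 * ε' by positivity)
    linarith
  have hlMN_lo : lyq * (1 - 90 * ε') ≤ lMN := by linarith [hMN.1]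
  have h90 : 90 * ε' ≤ 9 / 100 := by linarith
  have hlyq91 : lyq * (91 / 100) ≤ lyq * (1 - 90 * ε') :=
    mul_le_mul_of_nonneg_left (by linarith) hlyq0.le
  have hlMN0 : 0 < lMN :=
    lt_of_lt_of_le (by positivity : 0 < lyq * (91 / 100)) (hlyq91.trans hlMN_lo)
  have hZc0 : 0 < Zc := lt_of_lt_of_le (Real.rpow_pos_of_pos hx0 γ) hZc.2.2
  have hsqrt0 : 0 < MN ^ (1 / 2 : ℝ) := Real.rpow_pos_of_pos hMN0 _
  have hlsqrt : Real.log (MN ^ (1 / 2 : ℝ)) = lMN / 2 := by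
    rw [Real.log_rpow hMN0]; ring
  have hu0 : 0 < u := by rw [hu]; exact lt_min hZc0 hsqrt0
  set lu := Real.log u with hlu
  have hlu_le : lu ≤ lMN / 2 := by
    rw [hlu, ← hlsqrt]; exact Real.log_le_log hu0 (by rw [hu]; exact min_le_right _ _)
  have hlZc_lo : γ * L ≤ Real.log Zc := by
    rw [← hlz]; exact Real.log_le_log (Real.rpow_pos_of_pos hx0 γ) hZc.2.2
  have hlu0 : 0 < lu := by
    rw [hlu, hu]
    rcases min_choice Zc (MN ^ (1 / 2 : ℝ)) with h | h <;> rw [h]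
    · exact lt_of_lt_of_le hγL hlZc_lo
    · rw [hlsqrt]; linarith
  -- the quantities `Λ`
  set Λu := V u * lu with hΛu_def
  set Λz := V (x ^ γ) * Real.log (x ^ γ) with hΛz_def
  have hΛ0 := hΛ₀
  have hΛu_hi : Λu ≤ (1 + ε / 8) * Λ₀ := by
    have := (abs_le.mp hΛu).2; linarith
  have hΛz_lo : (1 - ε / 8) * Λ₀ ≤ Λz := by
    have := (abs_le.mp hΛz).1; linarith
  have hΛz0 : 0 < Λz := lt_of_lt_of_le (mul_pos (by linarith) hΛ0) hΛz_lo
  have hΛu0 : 0 ≤ Λu := mul_nonneg (hVpos u).le hlu0.le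
  have hΛuz : Λu ≤ Λz * (1 + 3 * (ε / 8)) := by
    have hlam : Λ₀ ≤ Λz / (1 - ε / 8) := by
      rw [le_div_iff₀ (by linarith)]; linarith
    have h2 : (1 + ε / 8) / (1 - ε / 8) ≤ 1 + 3 * (ε / 8) :=
      one_add_div_one_sub_le (by linarith) (by linarith)
    calc Λu ≤ (1 + ε / 8) * Λ₀ := hΛu_hi
      _ ≤ (1 + ε / 8) * (Λz / (1 - ε / 8)) := mul_le_mul_of_nonneg_left hlam (by linarith)
      _ = Λz * ((1 + ε / 8) / (1 - ε / 8)) := by ring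
      _ ≤ Λz * (1 + 3 * (ε / 8)) := mul_le_mul_of_nonneg_left h2 hΛz0.le
  -- the arguments `s_u`, `s_q` and their ranges
  set su := lMN / lu with hsu
  set sq := lyq / lzq with hsq
  have hSγ : 16 / (15 * γ) = (16 / 15) / γ := by rw [div_div]
  have hsu_lo : 2 ≤ su := by
    rw [hsu, le_div_iff₀ hlu0]; linarith
  have hsq_lo : 1 / 10 < sq := by
    rw [hsq, lt_div_iff₀ hlzq0]; linarith
  have hsq_hi : sq ≤ 16 / (15 * γ) := by
    rw [hsq, div_le_iff₀ hlzq0, hSγ, div_mul_eq_mul_div, le_div_iff₀ hγ]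
    calc lyq * γ ≤ 16 / 15 * L * γ := mul_le_mul_of_nonneg_right hlyq_hi hγ.le
      _ = 16 / 15 * (γ * L) := by ring
      _ ≤ 16 / 15 * lzq := mul_le_mul_of_nonneg_left hlzq_lo (by norm_num)
  have hsq_mem : sq ∈ Set.Icc (1 / 10 : ℝ) (16 / (15 * γ) + 2) := ⟨hsq_lo.le, by linarith⟩
  have hsq0 : 0 < sq := by linarith
  -- `G ≥ 0`
  have hGsu : 0 ≤ su * F su := hFf.mul_upper_nonneg (by linarith)
  have hGsq : 0 ≤ sq * F sq := hFf.mul_upper_nonneg hsq0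
  have hGsq_le : sq * F sq ≤ Gmax := (le_abs_self _).trans (hGmax sq hsq_mem)
  have hLg0 : (0 : ℝ) ≤ Lg := NNReal.coe_nonneg _
  -- (iii) `G(s_u) ≤ G(s_q) + 2 L_G ε/γ`
  have hG : su * F su ≤ sq * F sq + 2 * Lg * ε / γ := by
    rcases le_or_gt Zc (MN ^ (1 / 2 : ℝ)) with hcase | hcase
    · -- Case A: `u = Zc`
      have huZ : u = Zc := by rw [hu, min_eq_left hcase]
      have hlu_hi : lzq < lu + Real.log 2 := by
        rw [hlu, huZ, ← Real.log_mul hZc0.ne' (by norm_num)]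
        exact Real.log_lt_log hzq0 (by linarith [hZc.2.1])
      have hlu_le_lzq : lu ≤ lzq := by rw [hlu, huZ]; exact Real.log_le_log hZc0 hZc.1
      have hlu_lo : γ * L ≤ lu := by rw [hlu, huZ]; exact hlZc_lo
      have hsu_hi : su ≤ 16 / (15 * γ) := by
        rw [hsu, div_le_iff₀ hlu0, hSγ, div_mul_eq_mul_div, le_div_iff₀ hγ]
        calc lMN * γ ≤ 16 / 15 * L * γ :=
              mul_le_mul_of_nonneg_right (hMN.2.trans hlyq_hi) hγ.le
          _ = 16 / 15 * (γ * L) := by ring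
          _ ≤ 16 / 15 * lu := mul_le_mul_of_nonneg_left hlu_lo (by norm_num)
      have hsu_mem : su ∈ Set.Icc (1 / 10 : ℝ) (16 / (15 * γ) + 2) := ⟨by linarith, by linarith⟩
      -- `|su − sq| ≤ 2ε/γ`
      have hlog2 : Real.log 2 < 0.75 := by have := Real.log_two_lt_d9; linarith
      have hdiff : |su - sq| ≤ 2 * ε / γ := by
        have e : su - sq = (lMN - lyq) / lu + lyq * (lzq - lu) / (lu * lzq) := by
          rw [hsu, hsq]; field_simp; ring
        rw [e]
        have hA : |(lMN - lyq) / lu| ≤ 6 * ε' / γ := by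
          rw [abs_div, abs_of_pos hlu0, div_le_div_iff₀ hlu0 hγ]
          have h6 : 0 ≤ 6 * ε' * L := by positivity
          have habs : |lMN - lyq| ≤ 6 * ε' * L := by
            rw [abs_le]; constructor <;> linarith [hMN.1, hMN.2]
          calc |lMN - lyq| * γ ≤ 6 * ε' * L * γ := mul_le_mul_of_nonneg_right habs hγ.le
            _ = 6 * ε' * (γ * L) := by ring
            _ ≤ 6 * ε' * lu := mul_le_mul_of_nonneg_left hlu_lo (by positivity)
        have hB : |lyq * (lzq - lu) / (lu * lzq)| ≤ ε / γ := by
          rw [abs_div, abs_mul, abs_of_pos hlyq0, abs_of_nonneg (by linarith),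
            abs_of_pos (by positivity), div_le_div_iff₀ (by positivity) hγ]
          have h1 : lyq * (lzq - lu) * γ ≤ 16 / 15 * L * Real.log 2 * γ := by
            have : lyq * (lzq - lu) ≤ 16 / 15 * L * Real.log 2 :=
              mul_le_mul hlyq_hi (by linarith) (by linarith) (by positivity)
            exact mul_le_mul_of_nonneg_right this hγ.le
          have hεγL : 2 ≤ ε * γ * L := by
            have := (div_le_iff₀ hL0).mp hlogx; linarith
          have h3 : 16 / 15 * L * Real.log 2 * γ ≤ ε * (lu * lzq) := by
            calc 16 / 15 * L * Real.log 2 * γ = (16 / 15 * Real.log 2) * (γ * L) := by ring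
              _ ≤ 2 * (γ * L) := mul_le_mul_of_nonneg_right (by linarith) hγL.le
              _ ≤ (ε * γ * L) * (γ * L) := mul_le_mul_of_nonneg_right hεγL hγL.le
              _ = ε * ((γ * L) * (γ * L)) := by ring
              _ ≤ ε * (lu * lzq) := mul_le_mul_of_nonneg_left
                  (mul_le_mul hlu_lo hlzq_lo hγL.le hlu0.le) hε.le
          linarith
        calc |(lMN - lyq) / lu + lyq * (lzq - lu) / (lu * lzq)|
            ≤ |(lMN - lyq) / lu| + |lyq * (lzq - lu) / (lu * lzq)| := abs_add_le _ _
          _ ≤ 6 * ε' / γ + ε / γ := add_le_add hA hB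
          _ ≤ 2 * ε / γ := by
              rw [← add_div]; exact div_le_div_of_nonneg_right (by linarith) hγ.le
      have hLd := hLip.dist_le_mul su hsu_mem sq hsq_mem
      rw [Real.dist_eq, Real.dist_eq] at hLd
      have : su * F su - sq * F sq ≤ Lg * (2 * ε / γ) :=
        (le_abs_self _).trans (hLd.trans (mul_le_mul_of_nonneg_left hdiff hLg0))
      have e2 : (Lg : ℝ) * (2 * ε / γ) = 2 * Lg * ε / γ := by ring
      linarith
    · -- Case B: `u = (MN)^{1/2}`, `su = 2`, `sq ≤ 3`: both `G` values equal `A`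
      have huS : u = MN ^ (1 / 2 : ℝ) := by rw [hu, min_eq_right hcase.le]
      have hlu_eq : lu = lMN / 2 := by rw [hlu, huS, hlsqrt]
      have hsu2 : su = 2 := by rw [hsu, hlu_eq]; field_simp
      have hlzq_gt : lMN / 2 < lzq := by
        rw [← hlsqrt, hlzq]; exact Real.log_lt_log hsqrt0 (lt_of_lt_of_le hcase hZc.1)
      have hsq3 : sq ≤ 3 := by
        rw [hsq, div_le_iff₀ hlzq0]
        linarith [hlMN_lo, hlyq91]
      have hGu : su * F su = sieveA := by rw [hsu2]; exact hFf.upper_eq 2 two_pos (by norm_num)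
      have hGq : sq * F sq = sieveA := hFf.upper_eq sq hsq0 hsq3
      rw [hGu, ← hGq]
      have : 0 ≤ 2 * Lg * ε / γ := by positivity
      linarith
  -- (ii) `1/lMN ≤ (1 + 180 ε')/lyq`
  have hinvMN : 1 / lMN ≤ (1 + 180 * ε') / lyq := by
    rw [div_le_div_iff₀ hlMN0 hlyq0, one_mul]
    have h1 := one_div_one_sub_le (by positivity : 0 ≤ 90 * ε') (by linarith)
    have h2 : lyq ≤ lMN * (1 / (1 - 90 * ε')) := by
      rw [mul_one_div, le_div_iff₀ (by linarith)]; linarith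
    calc lyq ≤ lMN * (1 / (1 - 90 * ε')) := h2
      _ ≤ lMN * (1 + 2 * (90 * ε')) := mul_le_mul_of_nonneg_left h1 hlMN0.le
      _ = (1 + 180 * ε') * lMN := by ring
  -- rewrite both sides through `G`
  have hLHS : V u * F su = Λu * (su * F su) * (1 / lMN) := by
    have : V u = Λu / lu := by rw [hΛu_def]; field_simp
    rw [this, hsu]; field_simp
  have hRHS : Λz / lzq * (F sq + 10 * (Gmax + 4 * Lg / γ) * ε) =
      Λz * (sq * F sq) * (1 / lyq) + Λz / lzq * (10 * (Gmax + 4 * Lg / γ) * ε) := by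
    rw [hsq]; field_simp
  rw [hLHS, hRHS]
  -- combine (i), (ii), (iii)
  have hκ : (1 + 3 * (ε / 8)) * (1 + 180 * ε') ≤ 1 + 0.7 * ε := by
    have h1 : ε * ε' ≤ ε * (ε / 1000) := mul_le_mul_of_nonneg_left hε'ε hε.le
    have h2 : ε * ε ≤ ε := mul_le_of_le_one_right hε.le hε1
    have e : (1 + 3 * (ε / 8)) * (1 + 180 * ε') = 1 + 180 * ε' + 3 / 8 * ε + 135 / 2 * (ε * ε') := by
      ring
    rw [e]; linarith
  have hGL : 0 ≤ Gmax + 4 * Lg / γ := by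
    have : 0 ≤ Gmax := hGsq.trans hGsq_le
    positivity
  have step1 : Λu * (su * F su) * (1 / lMN) ≤
      Λz * (1 + 3 * (ε / 8)) * (sq * F sq + 2 * Lg * ε / γ) * ((1 + 180 * ε') / lyq) := by
    have h1 : Λu * (su * F su) ≤ Λz * (1 + 3 * (ε / 8)) * (sq * F sq + 2 * Lg * ε / γ) :=
      mul_le_mul hΛuz hG hGsu (by positivity)
    exact mul_le_mul h1 hinvMN (by positivity) (by positivity)
  have step2 : Λz * (1 + 3 * (ε / 8)) * (sq * F sq + 2 * Lg * ε / γ) * ((1 + 180 * ε') / lyq) ≤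
      Λz * (sq * F sq) * (1 / lyq) + Λz * (1 / lyq) * (ε * (Gmax + 4 * Lg / γ)) := by
    have e : Λz * (1 + 3 * (ε / 8)) * (sq * F sq + 2 * Lg * ε / γ) * ((1 + 180 * ε') / lyq) =
        Λz * (1 / lyq) * (((1 + 3 * (ε / 8)) * (1 + 180 * ε')) * (sq * F sq + 2 * Lg * ε / γ)) := by
      field_simp
    rw [e, show Λz * (sq * F sq) * (1 / lyq) + Λz * (1 / lyq) * (ε * (Gmax + 4 * Lg / γ)) =
      Λz * (1 / lyq) * (sq * F sq + ε * (Gmax + 4 * Lg / γ)) by ring]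
    refine mul_le_mul_of_nonneg_left ?_ (by positivity)
    have hLgγ : 0 ≤ (Lg : ℝ) / γ := by positivity
    have hin : 0.7 * (sq * F sq) + 2 * (Lg / γ) * (1 + 0.7 * ε) ≤ Gmax + 4 * Lg / γ := by
      have h3 : 2 * (Lg / γ) * (1 + 0.7 * ε) ≤ 2 * (Lg / γ) * 2 :=
        mul_le_mul_of_nonneg_left (by linarith) (by positivity)
      have h4 : 0.7 * (sq * F sq) ≤ Gmax := by linarith
      have e3 : 2 * ((Lg : ℝ) / γ) * 2 = 4 * Lg / γ := by ring
      linarith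
    calc (1 + 3 * (ε / 8)) * (1 + 180 * ε') * (sq * F sq + 2 * Lg * ε / γ)
        ≤ (1 + 0.7 * ε) * (sq * F sq + 2 * Lg * ε / γ) :=
          mul_le_mul_of_nonneg_right hκ (by positivity)
      _ = sq * F sq + ε * (0.7 * (sq * F sq) + 2 * (Lg / γ) * (1 + 0.7 * ε)) := by ring
      _ ≤ sq * F sq + ε * (Gmax + 4 * Lg / γ) := by
          have := mul_le_mul_of_nonneg_left hin hε.le
          linarith
  have step3 : Λz * (1 / lyq) * (ε * (Gmax + 4 * Lg / γ)) ≤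
      Λz / lzq * (10 * (Gmax + 4 * Lg / γ) * ε) := by
    have h1 : 1 / lyq ≤ 10 / lzq := by
      rw [div_le_div_iff₀ hlyq0 hlzq0]
      have : lzq < 10 * lyq := by
        rw [hsq, lt_div_iff₀ hlzq0] at hsq_lo; linarith
      linarith
    calc Λz * (1 / lyq) * (ε * (Gmax + 4 * Lg / γ))
        ≤ Λz * (10 / lzq) * (ε * (Gmax + 4 * Lg / γ)) := by
          refine mul_le_mul_of_nonneg_right (mul_le_mul_of_nonneg_left h1 hΛz0.le) ?_
          positivity
      _ = Λz / lzq * (10 * (Gmax + 4 * Lg / γ) * ε) := by ring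
  linarith [step1, step2, step3]


set_option maxHeartbeats 400000 in
/-- **`V(u)` against the target density** (p. 186): with `u = min(Z_c, (MN)^{1/2})` as above and
`Λ` within `λ₀/8` of `λ₀` at `u` and `z = x^γ`, `V(u) ≤ (V(z) log z / log z_q)(1/γ + 33)`
(`log u ≥ min(γ, 1/33) log x`). Used to absorb Lemma 2's `E`-term. [cite: IwaniecInventiones1978, §5 p. 186] -/
theorem densityProd_level_le_gen {V : ℝ → ℝ} {Λ₀ : ℝ} (hΛ₀ : 0 < Λ₀)
    {γ ε ε' x zq Zc MN u : ℝ} {q : ℕ} (hγ : 0 < γ)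
    (hε : 0 < ε) (hε1 : ε ≤ 1) (hε' : 0 ≤ ε') (hε'ε : ε' ≤ ε / 1000) (hx : 1 < x)
    (hzq : x ^ γ ≤ zq ∧ zq < x ^ (1 / 2 : ℝ)) (hq : 1 ≤ q ∧ (q : ℝ) < x ^ (1 - ε))
    (hZc : Zc ≤ zq ∧ x ^ γ ≤ Zc) (hMN0 : 0 < MN)
    (hMN : Real.log (x ^ (16 / 15 : ℝ) / q) - 6 * ε' * Real.log x ≤ Real.log MN)
    (hu : u = min Zc (MN ^ (1 / 2 : ℝ)))
    (hΛu : |V u * Real.log u - Λ₀| ≤ ε / 8 * Λ₀)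
    (hΛz : |V (x ^ γ) * Real.log (x ^ γ) - Λ₀| ≤ ε / 8 * Λ₀) :
    V u ≤ V (x ^ γ) * Real.log (x ^ γ) / Real.log zq * (1 / γ + 33) := by
  have hx0 : 0 < x := by linarith
  set L := Real.log x with hL
  have hL0 : 0 < L := Real.log_pos hx
  have hεL : 0 < ε * L := mul_pos hε hL0
  have hlz : Real.log (x ^ γ) = γ * L := Real.log_rpow hx0 γ
  have hγL : 0 < γ * L := mul_pos hγ hL0
  have hq0 : (0 : ℝ) < q := by exact_mod_cast hq.1
  have hq1 : (1 : ℝ) ≤ q := by exact_mod_cast hq.1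
  set lyq := Real.log (x ^ (16 / 15 : ℝ) / q) with hlyq
  have hlyq_eq : lyq = 16 / 15 * L - Real.log q := by
    rw [hlyq, Real.log_div (by positivity) hq0.ne', Real.log_rpow hx0]
  have hlogq : Real.log q < (1 - ε) * L := by
    rw [← Real.log_rpow hx0]; exact Real.log_lt_log hq0 hq.2
  have hlyq_lo : L / 15 < lyq := by rw [hlyq_eq]; linarith
  have hlyq0 : 0 < lyq := lt_trans (by positivity) hlyq_lo
  have hzq0 : 0 < zq := lt_of_lt_of_le (Real.rpow_pos_of_pos hx0 γ) hzq.1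
  set lzq := Real.log zq with hlzq
  have hlzq_hi : lzq < L / 2 := by
    have := Real.log_lt_log hzq0 hzq.2
    rw [Real.log_rpow hx0] at this; linarith
  have hlzq_lo : γ * L ≤ lzq := by
    rw [← hlz]; exact Real.log_le_log (Real.rpow_pos_of_pos hx0 γ) hzq.1
  have hlzq0 : 0 < lzq := lt_of_lt_of_le hγL hlzq_lo
  set lMN := Real.log MN with hlMN
  have hε'L : 6 * ε' * L ≤ 90 * ε' * lyq := by
    have := mul_le_mul_of_nonneg_left (show L ≤ 15 * lyq by linarith) (show 0 ≤ 6 * ε' by positivity)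
    linarith
  have h90 : 90 * ε' ≤ 9 / 100 := by linarith
  have hlyq91 : lyq * (91 / 100) ≤ lyq * (1 - 90 * ε') :=
    mul_le_mul_of_nonneg_left (by linarith) hlyq0.le
  have hlMN_lo : L / 33 ≤ lMN / 2 := by linarith [hMN, hε'L, hlyq91, hlyq_lo]
  have hZc0 : 0 < Zc := lt_of_lt_of_le (Real.rpow_pos_of_pos hx0 γ) hZc.2
  have hsqrt0 : 0 < MN ^ (1 / 2 : ℝ) := Real.rpow_pos_of_pos hMN0 _
  have hlsqrt : Real.log (MN ^ (1 / 2 : ℝ)) = lMN / 2 := by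
    rw [Real.log_rpow hMN0]; ring
  have hu0 : 0 < u := by rw [hu]; exact lt_min hZc0 hsqrt0
  set lu := Real.log u with hlu
  have hlZc_lo : γ * L ≤ Real.log Zc := by
    rw [← hlz]; exact Real.log_le_log (Real.rpow_pos_of_pos hx0 γ) hZc.2
  -- `lu ≥ min(γ, 1/33) L`
  set a : ℝ := min γ (1 / 33) with ha
  have ha0 : 0 < a := lt_min hγ (by norm_num)
  have haL : a * L ≤ lu := by
    rw [hlu, hu]
    rcases min_choice Zc (MN ^ (1 / 2 : ℝ)) with h | h <;> rw [h]
    · calc a * L ≤ γ * L := mul_le_mul_of_nonneg_right (min_le_left _ _) hL0.le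
        _ ≤ Real.log Zc := hlZc_lo
    · rw [hlsqrt]
      calc a * L ≤ 1 / 33 * L := mul_le_mul_of_nonneg_right (min_le_right _ _) hL0.le
        _ ≤ lMN / 2 := by linarith
  have hlu0 : 0 < lu := lt_of_lt_of_le (mul_pos ha0 hL0) haL
  set Λu := V u * lu with hΛu_def
  set Λz := V (x ^ γ) * Real.log (x ^ γ) with hΛz_def
  have hΛ0 := hΛ₀
  have hε8 : ε / 8 * Λ₀ ≤ 1 / 8 * Λ₀ := mul_le_mul_of_nonneg_right (by linarith) hΛ0.le
  have hΛu_hi : Λu ≤ 9 / 8 * Λ₀ := by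
    have := (abs_le.mp hΛu).2; linarith
  have hΛz_lo : 7 / 8 * Λ₀ ≤ Λz := by
    have := (abs_le.mp hΛz).1; linarith
  have hΛz0 : 0 < Λz := lt_of_lt_of_le (by positivity) hΛz_lo
  -- `V(u) = Λu/lu ≤ (9/8)λ₀/(aL)` and `Λz/lzq ≥ (7/8)λ₀/(L/2)`
  have hV : V u = Λu / lu := by rw [hΛu_def]; field_simp
  rw [hV]
  have h1 : Λu / lu ≤ 9 / 8 * Λ₀ / (a * L) := by
    rw [div_le_div_iff₀ hlu0 (mul_pos ha0 hL0)]
    calc Λu * (a * L) ≤ 9 / 8 * Λ₀ * (a * L) := mul_le_mul_of_nonneg_right hΛu_hi (by positivity)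
      _ ≤ 9 / 8 * Λ₀ * lu := mul_le_mul_of_nonneg_left haL (by positivity)
  have h2 : 7 / 4 * Λ₀ / L ≤ Λz / lzq := by
    rw [div_le_div_iff₀ hL0 hlzq0]
    calc 7 / 4 * Λ₀ * lzq ≤ 7 / 4 * Λ₀ * (L / 2) := mul_le_mul_of_nonneg_left hlzq_hi.le (by positivity)
      _ = 7 / 8 * Λ₀ * L := by ring
      _ ≤ Λz * L := mul_le_mul_of_nonneg_right hΛz_lo hL0.le
  have h3 : 1 / a ≤ 1 / γ + 33 := by
    rw [ha]
    rcases min_choice γ (1 / 33) with h | h <;> rw [h]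
    · linarith
    · have : 0 < 1 / γ := by positivity
      norm_num; linarith
  calc Λu / lu ≤ 9 / 8 * Λ₀ / (a * L) := h1
    _ = (7 / 4 * Λ₀ / L) * ((9 / 14) * (1 / a)) := by field_simp; ring
    _ ≤ (Λz / lzq) * ((9 / 14) * (1 / a)) := mul_le_mul_of_nonneg_right h2 (by positivity)
    _ ≤ (Λz / lzq) * (1 / γ + 33) := by
        refine mul_le_mul_of_nonneg_left ?_ (by positivity)
        have : 0 < 1 / a := by positivity
        linarith

set_option maxHeartbeats 400000 in
/-- **The main term of a single `q` for the lower bound at a constant level `Z ≤ (MN)^{1/2}`**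
("A similar result holds for lower bound, the function `F(s)` being replaced by `f(s)`", p. 185):
`V(Z) f(log MN/log Z) ≥ (V(z) log z/log Z)(f(log(y/q)/log Z) − (L_f/γ + f_max) ε)`.
[cite: IwaniecInventiones1978, Proposition 2] -/
theorem main_term_lower_gen {V : ℝ → ℝ} (hVpos : ∀ t, 0 < V t) {Λ₀ : ℝ} (hΛ₀ : 0 < Λ₀)
    {F f : ℝ → ℝ} (hFf : IsLinearSieveFunctions F f) {γ : ℝ} (hγ : 0 < γ)
    (hγ2 : γ < 1 / 2) {Lf : NNReal} {fmax : ℝ}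
    (hLip : LipschitzOnWith Lf f (Set.Icc (1 / 10) (16 / (15 * γ) + 2)))
    (hfmax : ∀ s ∈ Set.Icc (1 / 10 : ℝ) (16 / (15 * γ) + 2), |f s| ≤ fmax)
    {ε ε' x Z MN : ℝ} {q : ℕ} (hε : 0 < ε) (hε1 : ε ≤ 1) (hε' : 0 ≤ ε') (hε'ε : ε' ≤ ε / 1000)
    (hx : 1 < x) (hZ : x ^ γ ≤ Z ∧ Z < x ^ (1 / 2 : ℝ)) (hq : 1 ≤ q ∧ (q : ℝ) < x ^ (1 - ε))
    (hMN0 : 0 < MN) (hZMN : Z ≤ MN ^ (1 / 2 : ℝ))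
    (hMN : Real.log (x ^ (16 / 15 : ℝ) / q) - 6 * ε' * Real.log x ≤ Real.log MN ∧
      Real.log MN ≤ Real.log (x ^ (16 / 15 : ℝ) / q))
    (hΛZ : |V Z * Real.log Z - Λ₀| ≤ ε / 8 * Λ₀)
    (hΛz : |V (x ^ γ) * Real.log (x ^ γ) - Λ₀| ≤ ε / 8 * Λ₀) :
    V (x ^ γ) * Real.log (x ^ γ) / Real.log Z *
        (f (Real.log (x ^ (16 / 15 : ℝ) / q) / Real.log Z) - (Lf / γ + fmax) * ε) ≤
      V Z * f (Real.log MN / Real.log Z) := by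
  have hx0 : 0 < x := by linarith
  set L := Real.log x with hL
  have hL0 : 0 < L := Real.log_pos hx
  have hεL : 0 < ε * L := mul_pos hε hL0
  have hlz : Real.log (x ^ γ) = γ * L := Real.log_rpow hx0 γ
  have hγL : 0 < γ * L := mul_pos hγ hL0
  have hq0 : (0 : ℝ) < q := by exact_mod_cast hq.1
  have hq1 : (1 : ℝ) ≤ q := by exact_mod_cast hq.1
  set lyq := Real.log (x ^ (16 / 15 : ℝ) / q) with hlyq
  have hlyq_eq : lyq = 16 / 15 * L - Real.log q := by
    rw [hlyq, Real.log_div (by positivity) hq0.ne', Real.log_rpow hx0]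
  have hlogq0 : 0 ≤ Real.log q := Real.log_nonneg hq1
  have hlogq : Real.log q < (1 - ε) * L := by
    rw [← Real.log_rpow hx0]; exact Real.log_lt_log hq0 hq.2
  have hlyq_lo : L / 15 < lyq := by rw [hlyq_eq]; linarith
  have hlyq_hi : lyq ≤ 16 / 15 * L := by rw [hlyq_eq]; linarith
  have hlyq0 : 0 < lyq := lt_trans (by positivity) hlyq_lo
  have hZ0 : 0 < Z := lt_of_lt_of_le (Real.rpow_pos_of_pos hx0 γ) hZ.1
  set lZ := Real.log Z with hlZ
  have hlZ_lo : γ * L ≤ lZ := by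
    rw [← hlz]; exact Real.log_le_log (Real.rpow_pos_of_pos hx0 γ) hZ.1
  have hlZ_hi : lZ < L / 2 := by
    have := Real.log_lt_log hZ0 hZ.2
    rw [Real.log_rpow hx0] at this; linarith
  have hlZ0 : 0 < lZ := lt_of_lt_of_le hγL hlZ_lo
  set lMN := Real.log MN with hlMN
  have hlMN0 : 0 < lMN := by
    have hε'L : 6 * ε' * L ≤ 90 * ε' * lyq := by
      have := mul_le_mul_of_nonneg_left (show L ≤ 15 * lyq by linarith) (show 0 ≤ 6 * ε' by positivity)
      linarith
    have hlyq91 : lyq * (91 / 100) ≤ lyq * (1 - 90 * ε') :=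
      mul_le_mul_of_nonneg_left (by linarith) hlyq0.le
    have h0 : 0 < lyq * (91 / 100) := by positivity
    linarith [hMN.1]
  -- `Λ`
  set ΛZ := V Z * lZ with hΛZ_def
  set Λz := V (x ^ γ) * Real.log (x ^ γ) with hΛz_def
  have hΛ0 := hΛ₀
  have hΛZ_lo : (1 - ε / 8) * Λ₀ ≤ ΛZ := by
    have := (abs_le.mp hΛZ).1; linarith
  have hΛz_hi : Λz ≤ (1 + ε / 8) * Λ₀ := by
    have := (abs_le.mp hΛz).2; linarith
  have hΛz_lo : (1 - ε / 8) * Λ₀ ≤ Λz := by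
    have := (abs_le.mp hΛz).1; linarith
  have hΛz0 : 0 < Λz := lt_of_lt_of_le (mul_pos (by linarith) hΛ0) hΛz_lo
  have hΛZ0 : 0 ≤ ΛZ := mul_nonneg (hVpos Z).le hlZ0.le
  -- `ΛZ ≥ Λz (1 − ε/4)`
  have hΛZz : Λz * (1 - ε / 4) ≤ ΛZ := by
    have h1 : Λz * (1 - ε / 4) ≤ (1 + ε / 8) * Λ₀ * (1 - ε / 4) :=
      mul_le_mul_of_nonneg_right hΛz_hi (by linarith)
    have h2 : 0 ≤ ε ^ 2 / 32 * Λ₀ := by positivity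
    have e : (1 + ε / 8) * Λ₀ * (1 - ε / 4) = (1 - ε / 8) * Λ₀ - ε ^ 2 / 32 * Λ₀ := by
      ring
    linarith
  -- arguments
  set su := lMN / lZ with hsu
  set sq := lyq / lZ with hsq
  have hSγ : 16 / (15 * γ) = (16 / 15) / γ := by rw [div_div]
  have hsu_lo : 2 ≤ su := by
    rw [hsu, le_div_iff₀ hlZ0]
    have := Real.log_le_log hZ0 hZMN
    rw [Real.log_rpow hMN0] at this
    linarith
  have hsq_lo : 1 / 10 < sq := by
    rw [hsq, lt_div_iff₀ hlZ0]; linarith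
  have hsq_hi : sq ≤ 16 / (15 * γ) := by
    rw [hsq, div_le_iff₀ hlZ0, hSγ, div_mul_eq_mul_div, le_div_iff₀ hγ]
    calc lyq * γ ≤ 16 / 15 * L * γ := mul_le_mul_of_nonneg_right hlyq_hi hγ.le
      _ = 16 / 15 * (γ * L) := by ring
      _ ≤ 16 / 15 * lZ := mul_le_mul_of_nonneg_left hlZ_lo (by norm_num)
  have hsu_hi : su ≤ 16 / (15 * γ) := by
    rw [hsu, div_le_iff₀ hlZ0, hSγ, div_mul_eq_mul_div, le_div_iff₀ hγ]
    calc lMN * γ ≤ 16 / 15 * L * γ := mul_le_mul_of_nonneg_right (hMN.2.trans hlyq_hi) hγ.le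
      _ = 16 / 15 * (γ * L) := by ring
      _ ≤ 16 / 15 * lZ := mul_le_mul_of_nonneg_left hlZ_lo (by norm_num)
  have hsq_mem : sq ∈ Set.Icc (1 / 10 : ℝ) (16 / (15 * γ) + 2) := ⟨hsq_lo.le, by linarith⟩
  have hsu_mem : su ∈ Set.Icc (1 / 10 : ℝ) (16 / (15 * γ) + 2) := ⟨by linarith, by linarith⟩
  have hsq0 : 0 < sq := by linarith
  have hfsu : 0 ≤ f su := (hFf.nonneg (by linarith : (0 : ℝ) < su)).2
  have hfsq : 0 ≤ f sq := (hFf.nonneg hsq0).2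
  have hfsq_le : f sq ≤ fmax := (le_abs_self _).trans (hfmax sq hsq_mem)
  have hLf0 : (0 : ℝ) ≤ Lf := NNReal.coe_nonneg _
  -- `|su − sq| ≤ ε/γ`, hence `f(su) ≥ f(sq) − L_f ε/γ`
  have hdiff : |su - sq| ≤ ε / γ := by
    have e : su - sq = (lMN - lyq) / lZ := by rw [hsu, hsq]; field_simp
    rw [e, abs_div, abs_of_pos hlZ0, div_le_div_iff₀ hlZ0 hγ]
    have habs : |lMN - lyq| ≤ 6 * ε' * L := by
      have h6 : 0 ≤ 6 * ε' * L := by positivity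
      rw [abs_le]; constructor <;> linarith [hMN.1, hMN.2]
    calc |lMN - lyq| * γ ≤ 6 * ε' * L * γ := mul_le_mul_of_nonneg_right habs hγ.le
      _ = 6 * ε' * (γ * L) := by ring
      _ ≤ ε * (γ * L) := mul_le_mul_of_nonneg_right (by linarith) hγL.le
      _ ≤ ε * lZ := mul_le_mul_of_nonneg_left hlZ_lo hε.le
  have hfdiff : f sq - Lf * ε / γ ≤ f su := by
    have hLd := hLip.dist_le_mul sq hsq_mem su hsu_mem
    rw [Real.dist_eq, Real.dist_eq, abs_sub_comm sq su] at hLd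
    have : f sq - f su ≤ Lf * (ε / γ) :=
      (le_abs_self _).trans (hLd.trans (mul_le_mul_of_nonneg_left hdiff hLf0))
    have e2 : (Lf : ℝ) * (ε / γ) = Lf * ε / γ := by ring
    linarith
  -- assemble: `V(Z) f(su) = ΛZ f(su)/lZ`
  have hV : V Z = ΛZ / lZ := by rw [hΛZ_def]; field_simp
  rw [hV, div_mul_eq_mul_div, div_mul_eq_mul_div, div_le_div_iff_of_pos_right hlZ0]
  -- goal: `Λz * (f sq − C ε) ≤ ΛZ * f su`
  have hC0 : 0 ≤ (Lf : ℝ) / γ + fmax := by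
    have : 0 ≤ fmax := hfsq.trans hfsq_le
    positivity
  rcases le_or_gt (f sq - Lf * ε / γ) 0 with hneg | hpos
  · -- the target is nonpositive
    have h1 : f sq - (Lf / γ + fmax) * ε ≤ 0 := by
      have : Lf * ε / γ ≤ (Lf / γ + fmax) * ε := by
        have : 0 ≤ fmax * ε := mul_nonneg (hfsq.trans hfsq_le) hε.le
        have e : (Lf : ℝ) * ε / γ = Lf / γ * ε := by ring
        have e2 : ((Lf : ℝ) / γ + fmax) * ε = Lf / γ * ε + fmax * ε := by ring
        linarith
      linarith
    calc Λz * (f sq - (Lf / γ + fmax) * ε) ≤ 0 := mul_nonpos_of_nonneg_of_nonpos hΛz0.le h1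
      _ ≤ ΛZ * f su := mul_nonneg hΛZ0 hfsu
  · calc Λz * (f sq - (Lf / γ + fmax) * ε)
        ≤ Λz * (1 - ε / 4) * (f sq - Lf * ε / γ) := by
          have e : Λz * (1 - ε / 4) * (f sq - Lf * ε / γ) =
              Λz * (f sq - Lf / γ * ε - ε / 4 * (f sq - Lf * ε / γ)) := by ring
          rw [e]
          refine mul_le_mul_of_nonneg_left ?_ hΛz0.le
          have : ε / 4 * (f sq - Lf * ε / γ) ≤ fmax * ε := by
            have h3 : f sq - Lf * ε / γ ≤ fmax := by
              have : 0 ≤ (Lf : ℝ) * ε / γ := by positivity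
              linarith
            have h4 : ε / 4 * (f sq - Lf * ε / γ) ≤ ε * (f sq - Lf * ε / γ) :=
              mul_le_mul_of_nonneg_right (by linarith) hpos.le
            have h5 : ε * (f sq - Lf * ε / γ) ≤ ε * fmax := mul_le_mul_of_nonneg_left h3 hε.le
            linarith
          have e2 : ((Lf : ℝ) / γ + fmax) * ε = Lf / γ * ε + fmax * ε := by ring
          linarith
      _ ≤ ΛZ * f su := mul_le_mul hΛZz hfdiff hpos.le hΛZ0

set_option maxHeartbeats 400000 in
/-- **Lower bound, the case `Z > (MN)^{1/2}`** (then `s = log(y/q)/log Z < 2 + 360ε'`, so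
`f(s) ≤ 360 L_f ε'` and the claimed main term is nonpositive; `S ≥ 0` suffices).
[cite: IwaniecInventiones1978, Proposition 2] -/
theorem main_term_lower_trivial_gen {V : ℝ → ℝ} (hVpos : ∀ t, 0 < V t)
    {F f : ℝ → ℝ} (hFf : IsLinearSieveFunctions F f) {γ : ℝ}
    (hγ : 0 < γ) (hγ2 : γ < 1 / 2) {Lf : NNReal} {fmax : ℝ}
    (hLip : LipschitzOnWith Lf f (Set.Icc (1 / 10) (16 / (15 * γ) + 2)))
    (hfmax : ∀ s ∈ Set.Icc (1 / 10 : ℝ) (16 / (15 * γ) + 2), |f s| ≤ fmax)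
    {ε ε' x Z MN : ℝ} {q : ℕ} (hε : 0 < ε) (hε1 : ε ≤ 1) (hε' : 0 ≤ ε') (hε'ε : ε' ≤ ε / 1000)
    (hx : 1 < x) (hZ : x ^ γ ≤ Z ∧ Z < x ^ (1 / 2 : ℝ)) (hq : 1 ≤ q ∧ (q : ℝ) < x ^ (1 - ε))
    (hMN0 : 0 < MN) (hZMN : MN ^ (1 / 2 : ℝ) < Z)
    (hMN : Real.log (x ^ (16 / 15 : ℝ) / q) - 6 * ε' * Real.log x ≤ Real.log MN) :
    V (x ^ γ) * Real.log (x ^ γ) / Real.log Z *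
        (f (Real.log (x ^ (16 / 15 : ℝ) / q) / Real.log Z) - (Lf / γ + fmax) * ε) ≤ 0 := by
  have hx0 : 0 < x := by linarith
  set L := Real.log x with hL
  have hL0 : 0 < L := Real.log_pos hx
  have hεL : 0 < ε * L := mul_pos hε hL0
  have hlz : Real.log (x ^ γ) = γ * L := Real.log_rpow hx0 γ
  have hγL : 0 < γ * L := mul_pos hγ hL0
  have hq0 : (0 : ℝ) < q := by exact_mod_cast hq.1
  have hq1 : (1 : ℝ) ≤ q := by exact_mod_cast hq.1
  set lyq := Real.log (x ^ (16 / 15 : ℝ) / q) with hlyq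
  have hlyq_eq : lyq = 16 / 15 * L - Real.log q := by
    rw [hlyq, Real.log_div (by positivity) hq0.ne', Real.log_rpow hx0]
  have hlogq0 : 0 ≤ Real.log q := Real.log_nonneg hq1
  have hlogq : Real.log q < (1 - ε) * L := by
    rw [← Real.log_rpow hx0]; exact Real.log_lt_log hq0 hq.2
  have hlyq_lo : L / 15 < lyq := by rw [hlyq_eq]; linarith
  have hlyq_hi : lyq ≤ 16 / 15 * L := by rw [hlyq_eq]; linarith
  have hlyq0 : 0 < lyq := lt_trans (by positivity) hlyq_lo
  have hZ0 : 0 < Z := lt_of_lt_of_le (Real.rpow_pos_of_pos hx0 γ) hZ.1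
  set lZ := Real.log Z with hlZ
  have hlZ_lo : γ * L ≤ lZ := by
    rw [← hlz]; exact Real.log_le_log (Real.rpow_pos_of_pos hx0 γ) hZ.1
  have hlZ0 : 0 < lZ := lt_of_lt_of_le hγL hlZ_lo
  set lMN := Real.log MN with hlMN
  have hε'L : 6 * ε' * L ≤ 90 * ε' * lyq := by
    have := mul_le_mul_of_nonneg_left (show L ≤ 15 * lyq by linarith) (show 0 ≤ 6 * ε' by positivity)
    linarith
  have hlMN_lo : lyq * (1 - 90 * ε') ≤ lMN := by linarith
  have h90 : 90 * ε' ≤ 9 / 100 := by linarith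
  -- `lZ > lMN/2`, so `sq = lyq/lZ < 2 lyq/lMN ≤ 2/(1 − 90ε') ≤ 2 + 360 ε'`
  have hsqrt0 : 0 < MN ^ (1 / 2 : ℝ) := Real.rpow_pos_of_pos hMN0 _
  have hlZ_gt : lMN / 2 < lZ := by
    have := Real.log_lt_log hsqrt0 hZMN
    rw [Real.log_rpow hMN0] at this; linarith
  set sq := lyq / lZ with hsq
  have hsq0 : 0 < sq := div_pos hlyq0 hlZ0
  have hsq_lo : 1 / 10 < sq := by
    rw [hsq, lt_div_iff₀ hlZ0]
    have : lZ < L / 2 := by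
      have := Real.log_lt_log hZ0 hZ.2
      rw [Real.log_rpow hx0] at this; linarith
    linarith
  have hsq_hi : sq ≤ 2 + 360 * ε' := by
    rw [hsq, div_le_iff₀ hlZ0]
    -- `lyq ≤ (2 + 360ε') lZ` since `lyq (1 − 90ε') ≤ lMN < 2 lZ` and `1/(1−90ε') ≤ 1 + 180 ε'`
    have h1 : lyq ≤ lMN * (1 + 180 * ε') := by
      have hh := one_div_one_sub_le (by positivity : 0 ≤ 90 * ε') (by linarith)
      have hlyq91 : lyq * (91 / 100) ≤ lyq * (1 - 90 * ε') :=
        mul_le_mul_of_nonneg_left (by linarith) hlyq0.le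
      have hlMN0 : 0 < lMN :=
        lt_of_lt_of_le (by positivity : 0 < lyq * (91 / 100)) (hlyq91.trans hlMN_lo)
      have h2 : lyq ≤ lMN * (1 / (1 - 90 * ε')) := by
        rw [mul_one_div, le_div_iff₀ (by linarith)]; linarith
      exact h2.trans (mul_le_mul_of_nonneg_left (by linarith) hlMN0.le)
    have h3 : lMN * (1 + 180 * ε') ≤ 2 * lZ * (1 + 180 * ε') :=
      mul_le_mul_of_nonneg_right (by linarith) (by positivity)
    have e : 2 * lZ * (1 + 180 * ε') = (2 + 360 * ε') * lZ := by ring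
    linarith
  have hΛz0 : 0 ≤ V (x ^ γ) * Real.log (x ^ γ) / lZ :=
    div_nonneg (mul_nonneg (hVpos _).le (by rw [hlz]; positivity)) hlZ0.le
  refine mul_nonpos_of_nonneg_of_nonpos hΛz0 ?_
  -- `f(sq) ≤ 360 L_f ε' ≤ (L_f/γ + fmax) ε`
  have hLf0 : (0 : ℝ) ≤ Lf := NNReal.coe_nonneg _
  have hfmax0 : 0 ≤ fmax := by
    have h2mem : (2 : ℝ) ∈ Set.Icc (1 / 10 : ℝ) (16 / (15 * γ) + 2) := by
      constructor
      · norm_num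
      · have : 0 < 16 / (15 * γ) := by positivity
        linarith
    have := hfmax 2 h2mem
    rw [hFf.lower_eq_zero two_pos le_rfl, abs_zero] at this
    exact this
  have hfsq : f sq ≤ 360 * Lf * ε' := by
    rcases le_or_gt sq 2 with h2 | h2
    · rw [hFf.lower_eq_zero hsq0 h2]; positivity
    · have hSγ2 : (2 : ℝ) + 360 * ε' ≤ 16 / (15 * γ) + 2 := by
        have : (2 : ℝ) ≤ 16 / (15 * γ) := by
          rw [div_eq_mul_inv, le_mul_inv_iff₀ (by positivity)]; linarith
        linarith
      have hsq_mem : sq ∈ Set.Icc (1 / 10 : ℝ) (16 / (15 * γ) + 2) := ⟨hsq_lo.le, by linarith⟩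
      have h2mem : (2 : ℝ) ∈ Set.Icc (1 / 10 : ℝ) (16 / (15 * γ) + 2) :=
        ⟨by norm_num, by linarith⟩
      have hLd := hLip.dist_le_mul sq hsq_mem 2 h2mem
      rw [Real.dist_eq, Real.dist_eq, hFf.lower_eq_zero two_pos le_rfl, sub_zero,
        abs_of_pos (by linarith : 0 < sq - 2)] at hLd
      calc f sq ≤ |f sq| := le_abs_self _
        _ ≤ Lf * (sq - 2) := hLd
        _ ≤ Lf * (360 * ε') := mul_le_mul_of_nonneg_left (by linarith) hLf0
        _ = 360 * Lf * ε' := by ring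
  have : 360 * Lf * ε' ≤ (Lf / γ + fmax) * ε := by
    have h1 : 360 * (Lf : ℝ) * ε' ≤ Lf * ε := by
      have := mul_le_mul_of_nonneg_left hε'ε (by positivity : 0 ≤ 360 * (Lf : ℝ))
      have h0 : 0 ≤ (Lf : ℝ) * ε := by positivity
      linarith
    have h2 : (Lf : ℝ) * ε ≤ Lf / γ * ε := by
      refine mul_le_mul_of_nonneg_right ?_ hε.le
      rw [le_div_iff₀ hγ]
      exact mul_le_of_le_one_right hLf0 (by linarith)
    have h3 : 0 ≤ fmax * ε := by positivity
    have e : ((Lf : ℝ) / γ + fmax) * ε = Lf / γ * ε + fmax * ε := by ring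
    linarith
  linarith

end Literature.NumberTheory.Sieve.Iwaniec1978

end
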